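import Literature.NumberTheory.LFunctions.BondarenkoHeap2026OffDiagReductionProofs
import Literature.NumberTheory.LFunctions.MellinSeparatedWeights
import Literature.Analysis.Fourier.SincSmooth
import HarnessLib

/-!
# Bondarenko–Heap 2026, §6.2: the kernels of the separation of variables (layer L3bK of the
# `offDiag_reduction′` programme) — `y`-side profile `V_N`, `u`-side kernel `W_{U,t}`, the separated
# weights `α`, `β`, their uniform derivative bounds, Mellin decay on `Re s = 0` and truncated expansions

LABEL (cell `rh-crit`, corpus C5 / rh-crit-ah; LADDER-RH §4 HELD «conditional bridges: exceptional
zero ⇒ …»): **NOT RH-BEARING.** RH-free real/complex analysis (dyadic cut-offs, Leibniz and Faà di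
Bruno bounds, Mellin transforms of `C_c^∞` functions on `[1,2]`) inside the §6.2 reduction of the
unrefereed preprint A. Bondarenko, W. Heap, arXiv:2608.07399v1; no `ζ`, no Siegel zero, nothing here
bears on the truth of RH. No named facts; seven plumbing definitions; theorems only otherwise.

## What is separated, and how (the cell's L3 design of record, ah/STATUS R-g5-39)

After the dyadic partitions in `k ≍ K`, `m ≍ M`, `r ≍ R` (`BondarenkoHeap2026OffDiagPartition`,
`SmoothDyadicPartition`), a box of the off-diagonal `𝒪𝒟` is, by `jTerm_eq_vonMangoldt_mul`, a sum of
`Λ(k) χ(m) χ(n) · g_h(k) G(m) G(n) (kmn)^{−1/2} Ŵ_T(log(km/n)/2π)` with `n = km + sr`,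
`s ∈ {1, −1}`. Writing `u := r/(km)` (so `n = km(1+su)`) the couplings between `k, m, r` sit in
exactly two one-variable functions: `G(n) n^{−1/2}` — a function of `y := n/N` once a fourth
partition `∑_N ω(n/N)² = 1` is inserted — and `Ŵ_T(log(1+su)/2π)` (`Ŵ_T` even) — a function of `u`,
localised by a fifth partition `∑_U ω(u/U)² = 1`. The paper separates all variables at once by a
triple inverse Mellin transform of a `C_c^∞([1,2]³)` function ("`𝓕(k,m,r) = (2πi)^{−3}∫∫∫ 𝓕̃₀(s) (K/k)^{s₁}(M/m)^{s₂}(R/r)^{s₃} ds`",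
TeX l.795–799, "integration by parts shows that `𝓕̃₀(s₁,s₂,s₃) ≪_j ∏(1+|t_i|)^{−j}`", l.800–804,
"We then truncate the `s_j` integrals at height `q^ε`", l.806, "differentiating `(K/x)^{s₁}` with
respect to `x` gives a factor of `−s₁` which is then `≪ q^ε`", l.810); the cell performs instead TWO
NESTED ONE-VARIABLE truncated inversions on the line `Re s = 0` with the landed `[1,2]`-toolkit
(`BondarenkoHeap2026.PrimeSums.norm_mellin_le_of_iteratedDeriv`, `MellinSeparated.mellin_truncated_inversion`):
first `V_N(y) = (1/2π)∫_{−H}^{H} 𝓜V_N(it) y^{−it} dt + O_j(H^{1−j})` in `y = n/N = (km/N)(1+su)` —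
the factor `(1+su)^{−it}` so produced is EXPLICIT and is absorbed into the `u`-kernel
`W_{U,t}(v) = ω(v)² Ŵ_T(log(1+sUv)/2π)/T · (1+sUv)^{−it}` — then the same expansion for `W_{U,t}`
in `v = u/U`, uniformly in `|t| ≤ H`. Every derivative in `v` costs a factor `U·T` (from
`|Ŵ_T^{(n)}| ≤ C_n T^{n+1}`, `abs_iteratedDeriv_weightHat_le`) or `U·(|t|+n)` (from the power), both
`O(1)` on contributing boxes (`U·T ≪ σ`, `U·H ≤ U·T`), which is why no multi-variable or parametric
inversion is needed. This file supplies the KERNEL side of that design (interface SIG-L3bK frozen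
on the cell board 2026-08-26T12:45Z; consumer: `BondarenkoHeap2026OffDiagReductionAssembly`).

## Contents

* Generic calculus (`namespace OffDiagKernels`): dilations/affine substitutions commute with
  `iteratedDeriv` with NO differentiability hypothesis (`iteratedDeriv_comp_mul_left`,
  `iteratedDeriv_comp_const_add_mul`); pointwise and cut-off Leibniz bounds
  (`norm_iteratedDeriv_mul_le`, `contDiff_mul_of_support`, `norm_iteratedDeriv_mul_le_of_support`);
  `iteratedDeriv_log_succ`, `norm_iteratedDeriv_log_affine_le`; the one-variable Faà di Bruno bound
  `norm_iteratedDeriv_comp_le` (Mathlib's `norm_iteratedFDerivWithin_comp_le`) and its `∘ log`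
  specialisation; uniform bounds for `y ↦ P(log(Xy)/log L)`, `y ↦ y^r`, dilations; the generic
  `[1,2]`-profile `ω(y)²·F(y)·y^{−1/2}` (`exists_profile_family`); the `G`-factor and the `sinc`
  factor `sin(h log(Ky)/2)/log(Ky) = (h/2) sinc(h log(Ky)/2)` (tree `Literature.Analysis.Fourier.SincSmooth`).
* (K1) `odV`, `odW`, `nA`, `odAlphaProfile`, `odAlpha`, `nB`, `odBetaProfile`, `odBeta` and the four
  rewriting identities at integer points `odV_id`, `odW_id`, `odAlpha_id`, `odBeta_id`.
* (K2a) `contDiff_odV`, `odV_ne_zero_imp`, `exists_family_odV`; `contDiff_odW`, `odW_ne_zero_imp`,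
  `exists_family_odW` (uniform all-order bounds under `1 ≤ T`, `0 < U ≤ 1/4`, `U·T ≤ C_U`,
  `U·|t| ≤ C_U`, `s = ±1`).
* (K2b–d) `mellin_decay_of_iteratedDeriv_bounds`, `truncated_of_iteratedDeriv_bounds` (line
  `Re s = 0`), `odV_mellin_decay`, `odV_truncated`, `odW_mellin_decay`, `odW_truncated`,
  `continuous_mellin_odW`.
* (K3) `exists_family_odAlpha`, `exists_family_odBeta`: the separated `k`- and `m`-weights lie in
  the corrected class `IsSmoothDyadicWeight'` (`BondarenkoHeap2026Section6Weights`) with ONE family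
  `A` each (loss `1 + ‖z‖` at the Mellin height `z`), via `MellinSeparated.isSmoothDyadicWeight'_separatedWeight`.

Quotation hygiene (cell rule R-g5-39 (c)): text inside quotation marks is verbatim TeX of
arXiv:2608.07399v1; the `u = r/(km)` / `y = n/N` bookkeeping, the fourth and fifth partitions and the
line `Re s = 0` are OURS (the print separates by a triple transform on lines `Re s_i = ε`).

## References

* [BondarenkoHeap2026] A. Bondarenko, W. Heap, arXiv:2608.07399v1, Proposition 1 p. 7 (`g_h`),
  §2.3 p. 8 (`G(n)`), §6.2 (TeX l.742–847: l.750–753 partition, l.785–795 expansion of `G₀`,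
  l.795–811 separation of variables, l.834–836 weights).
* [Titchmarsh1948] E. C. Titchmarsh, *Introduction to the Theory of Fourier Integrals*, §1.29.
-/

noncomputable section

open Real Complex MeasureTheory Set Filter
open scoped ContDiff Topology FourierTransform

namespace Literature.NumberTheory.LFunctions.BondarenkoHeap2026

open Literature.NumberTheory.LFunctions.SmoothDyadicPartition (bump bump_contDiff bump_nonneg
  bump_le_one bump_ne_zero_imp bump_contDiff_ofReal exists_bound_iteratedDeriv_bump)

namespace OffDiagKernels

section Calculus

variable {F : Type*} [NormedAddCommGroup F] [NormedSpace ℝ F]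

/-- **Dilations commute with iterated derivatives**, with no differentiability hypothesis:
`(d/dx)ⁿ [f(cx)] = cⁿ • f⁽ⁿ⁾(cx)`. [cite: BondarenkoHeap2026, §6.2, TeX l.808–811] -/
theorem iteratedDeriv_comp_mul_left (f : ℝ → F) (c : ℝ) (n : ℕ) :
    iteratedDeriv n (fun x => f (c * x)) = fun x => c ^ n • iteratedDeriv n f (c * x) := by
  induction n with
  | zero => funext x; simp
  | succ n ih =>
    funext x
    rw [iteratedDeriv_succ, ih]
    have h1 : deriv (fun x => c ^ n • iteratedDeriv n f (c * x)) x =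
        c ^ n • deriv (fun x => iteratedDeriv n f (c * x)) x :=
      deriv_const_smul_field (c ^ n) (fun x => iteratedDeriv n f (c * x))
    rw [h1, deriv_comp_mul_left c (iteratedDeriv n f) x, ← iteratedDeriv_succ, smul_smul, pow_succ]

/-- **Affine substitutions commute with iterated derivatives**:
`(d/dx)ⁿ [f(b + cx)] = cⁿ • f⁽ⁿ⁾(b + cx)`. [cite: BondarenkoHeap2026, §6.2, TeX l.808–811] -/
theorem iteratedDeriv_comp_const_add_mul (f : ℝ → F) (b c : ℝ) (n : ℕ) (x : ℝ) :
    iteratedDeriv n (fun x => f (b + c * x)) x = c ^ n • iteratedDeriv n f (b + c * x) := by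
  have h1 : (fun x => f (b + c * x)) = fun x => (fun y => f (b + y)) (c * x) := rfl
  rw [h1, iteratedDeriv_comp_mul_left (fun y => f (b + y)) c n]
  simp only [iteratedDeriv_comp_const_add]

variable {𝔸 : Type*} [RCLike 𝔸]

/-- **Pointwise Leibniz bound**: if `‖f⁽ⁱ⁾(x)‖ ≤ aᵢ` and `‖g⁽ⁱ⁾(x)‖ ≤ bᵢ` for `i ≤ n` (both `Cⁿ`
at `x`), then `‖(fg)⁽ⁿ⁾(x)‖ ≤ Σᵢ C(n,i) aᵢ b_{n−i}`. [cite: BondarenkoHeap2026, §6.2, TeX l.834–836] -/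
theorem norm_iteratedDeriv_mul_le {f g : ℝ → 𝔸} {x : ℝ} {n : ℕ} (hf : ContDiffAt ℝ n f x)
    (hg : ContDiffAt ℝ n g x) {a b : ℕ → ℝ} (ha : ∀ i, i ≤ n → ‖iteratedDeriv i f x‖ ≤ a i)
    (hb : ∀ i, i ≤ n → ‖iteratedDeriv i g x‖ ≤ b i) :
    ‖iteratedDeriv n (fun y => f y * g y) x‖ ≤
      ∑ i ∈ Finset.range (n + 1), (n.choose i : ℝ) * a i * b (n - i) := by
  have hmul : (fun y => f y * g y) = f * g := rfl
  rw [hmul, iteratedDeriv_mul hf hg]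
  refine (norm_sum_le _ _).trans (Finset.sum_le_sum fun i hi => ?_)
  rw [Finset.mem_range] at hi
  rw [norm_mul, norm_mul, RCLike.norm_natCast]
  have h1 := ha i (by omega)
  have h2 := hb (n - i) (by omega)
  have ha0 : 0 ≤ a i := (norm_nonneg _).trans h1
  exact mul_le_mul (mul_le_mul_of_nonneg_left h1 (Nat.cast_nonneg _)) h2 (norm_nonneg _)
    (mul_nonneg (Nat.cast_nonneg _) ha0)

/-- A function vanishing off `[1,2]` has all its iterated derivatives vanishing off `[1,2]`.
[cite: BondarenkoHeap2026, §6.2, TeX l.834–836] -/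
theorem iteratedDeriv_eq_zero_of_support {φ : ℝ → 𝔸} (hsupp : ∀ y, φ y ≠ 0 → 1 ≤ y ∧ y ≤ 2)
    (n : ℕ) {y : ℝ} (hy : y < 1 ∨ 2 < y) : iteratedDeriv n φ y = 0 := by
  have hzero : ∀ z : ℝ, (z < 1 ∨ 2 < z) → φ z = 0 := by
    intro z hz
    by_contra h
    rcases hz with hz | hz
    · exact absurd (hsupp z h).1 (not_le.2 hz)
    · exact absurd (hsupp z h).2 (not_le.2 hz)
  have hev : φ =ᶠ[𝓝 y] fun _ => (0 : 𝔸) := by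
    rcases hy with hy | hy
    · filter_upwards [Iio_mem_nhds hy] with z hz using hzero z (Or.inl hz)
    · filter_upwards [Ioi_mem_nhds hy] with z hz using hzero z (Or.inr hz)
  rw [hev.iteratedDeriv_eq n, iteratedDeriv_const]
  split_ifs <;> rfl

/-- **Cut-off products are globally smooth**: if `ψ` is smooth and vanishes off `[1,2]` and `F` is
smooth at every point of `[1,2]`, then `ψ · F` is smooth on `ℝ`. [cite: BondarenkoHeap2026, §6.2, TeX l.834–836] -/
theorem contDiff_mul_of_support {ψ F : ℝ → 𝔸} (hψ : ContDiff ℝ ∞ ψ)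
    (hsupp : ∀ y, ψ y ≠ 0 → 1 ≤ y ∧ y ≤ 2) (hF : ∀ y ∈ Set.Icc (1 : ℝ) 2, ContDiffAt ℝ ∞ F y) :
    ContDiff ℝ ∞ fun y => ψ y * F y := by
  refine contDiff_iff_contDiffAt.2 fun y => ?_
  by_cases hy : y ∈ Set.Icc (1 : ℝ) 2
  · exact hψ.contDiffAt.mul (hF y hy)
  · have hy' : y < 1 ∨ 2 < y := by
      rcases not_and_or.1 hy with h | h
      · exact Or.inl (not_le.1 h)
      · exact Or.inr (not_le.1 h)
    have hsupp' : ∀ z, ψ z * F z ≠ 0 → 1 ≤ z ∧ z ≤ 2 :=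
      fun z hz => hsupp z (left_ne_zero_of_mul hz)
    have hev : (fun y => ψ y * F y) =ᶠ[𝓝 y] fun _ => (0 : 𝔸) := by
      have hzero : ∀ z : ℝ, (z < 1 ∨ 2 < z) → ψ z * F z = 0 := by
        intro z hz
        by_contra h
        rcases hz with hz | hz
        · exact absurd (hsupp' z h).1 (not_le.2 hz)
        · exact absurd (hsupp' z h).2 (not_le.2 hz)
      rcases hy' with hy' | hy'
      · filter_upwards [Iio_mem_nhds hy'] with z hz using hzero z (Or.inl hz)
      · filter_upwards [Ioi_mem_nhds hy'] with z hz using hzero z (Or.inr hz)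
    exact contDiffAt_const.congr_of_eventuallyEq hev

/-- **Leibniz bound for a cut-off product**: `ψ` smooth, vanishing off `[1,2]`, with
`‖ψ⁽ⁱ⁾‖_∞ ≤ bᵢ`; `F` smooth at the points of `[1,2]` with `‖F⁽ⁱ⁾(y)‖ ≤ cᵢ` there (`i ≤ n`); then
`‖(ψF)⁽ⁿ⁾(y)‖ ≤ Σᵢ C(n,i) bᵢ c_{n−i}` for EVERY real `y`. [cite: BondarenkoHeap2026, §6.2, TeX l.834–836] -/
theorem norm_iteratedDeriv_mul_le_of_support {ψ F : ℝ → 𝔸} (hψ : ContDiff ℝ ∞ ψ)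
    (hsupp : ∀ y, ψ y ≠ 0 → 1 ≤ y ∧ y ≤ 2) (hF : ∀ y ∈ Set.Icc (1 : ℝ) 2, ContDiffAt ℝ ∞ F y)
    {n : ℕ} {b c : ℕ → ℝ} (hb : ∀ i y, ‖iteratedDeriv i ψ y‖ ≤ b i)
    (hc : ∀ i, i ≤ n → ∀ y ∈ Set.Icc (1 : ℝ) 2, ‖iteratedDeriv i F y‖ ≤ c i)
    (hc0 : ∀ i, 0 ≤ c i) (y : ℝ) :
    ‖iteratedDeriv n (fun y => ψ y * F y) y‖ ≤
      ∑ i ∈ Finset.range (n + 1), (n.choose i : ℝ) * b i * c (n - i) := by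
  by_cases hy : y ∈ Set.Icc (1 : ℝ) 2
  · exact norm_iteratedDeriv_mul_le (hψ.contDiffAt.of_le (by exact_mod_cast le_top))
      ((hF y hy).of_le (by exact_mod_cast le_top))
      (fun i _ => hb i y) (fun i hi => hc i hi y hy)
  · have hy' : y < 1 ∨ 2 < y := by
      rcases not_and_or.1 hy with h | h
      · exact Or.inl (not_le.1 h)
      · exact Or.inr (not_le.1 h)
    have hsupp' : ∀ z, ψ z * F z ≠ 0 → 1 ≤ z ∧ z ≤ 2 :=
      fun z hz => hsupp z (left_ne_zero_of_mul hz)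
    rw [iteratedDeriv_eq_zero_of_support hsupp' n hy', norm_zero]
    exact Finset.sum_nonneg fun i _ =>
      mul_nonneg (mul_nonneg (Nat.cast_nonneg _) ((norm_nonneg _).trans (hb i 0))) (hc0 _)


/-! ### Iterated derivatives of `log` and of `v ↦ log(1 + a v)` -/

/-- `log⁽ⁱ⁺¹⁾(x) = (−1)ⁱ i! x^{−1−i}` (Mathlib's `log` on all of `ℝ`; both sides vanish suitably at
`0`). [cite: BondarenkoHeap2026, §6.2, TeX l.800–811] -/
theorem iteratedDeriv_log_succ (i : ℕ) (x : ℝ) :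
    iteratedDeriv (i + 1) Real.log x = (-1) ^ i * (Nat.factorial i) * x ^ (-1 - i : ℤ) := by
  rw [iteratedDeriv_succ', Real.deriv_log', iteratedDeriv_eq_iterate, iter_deriv_inv]

/-- `|log⁽ⁱ⁾(x)| ≤ (i−1)!/|x|ⁱ ≤ i^i · (1/|x|)^i`-type bound: for `i ≥ 1` and `x ≠ 0`,
`‖log⁽ⁱ⁾(x)‖ = (i−1)! |x|^{−i}`. [cite: BondarenkoHeap2026, §6.2, TeX l.800–811] -/
theorem norm_iteratedDeriv_log {i : ℕ} (hi : 1 ≤ i) {x : ℝ} (hx : 0 < x) :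
    ‖iteratedDeriv i Real.log x‖ = (Nat.factorial (i - 1) : ℝ) * (x ^ i)⁻¹ := by
  obtain ⟨j, rfl⟩ : ∃ j, i = j + 1 := ⟨i - 1, by omega⟩
  rw [iteratedDeriv_log_succ, Nat.add_sub_cancel]
  rw [Real.norm_eq_abs, abs_mul, abs_mul, abs_pow, abs_neg, abs_one, one_pow, one_mul,
    Nat.abs_cast]
  congr 1
  rw [show (-1 - j : ℤ) = -((j + 1 : ℕ) : ℤ) by push_cast; ring, zpow_neg, zpow_natCast,
    abs_inv, abs_pow, abs_of_pos hx]

/-- Iterated derivatives of `v ↦ log(1 + a v)`: `aⁱ · log⁽ⁱ⁾(1 + a v)`. [cite: BondarenkoHeap2026, §6.2, TeX l.800–811] -/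
theorem iteratedDeriv_log_affine (a : ℝ) (i : ℕ) (v : ℝ) :
    iteratedDeriv i (fun v => Real.log (1 + a * v)) v = a ^ i * iteratedDeriv i Real.log (1 + a * v) := by
  rw [iteratedDeriv_comp_const_add_mul Real.log 1 a i v, smul_eq_mul]

/-- **Derivative bounds for the inner function `v ↦ log(1 + a v)/(2π)`**: for `i ≥ 1` and
`1 + a v ≥ 1/2`, `‖(log(1 + a·)/(2π))⁽ⁱ⁾(v)‖ ≤ (2 |a| i)ⁱ`. [cite: BondarenkoHeap2026, §6.2, TeX l.800–811] -/
theorem norm_iteratedDeriv_log_affine_le {a v : ℝ} (hav : 1 / 2 ≤ 1 + a * v) {i : ℕ} (hi : 1 ≤ i) :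
    ‖iteratedDeriv i (fun v => Real.log (1 + a * v) / (2 * π)) v‖ ≤ (2 * |a| * i) ^ i := by
  have hpos : 0 < 1 + a * v := by linarith
  rw [iteratedDeriv_div_const, iteratedDeriv_log_affine, norm_div, norm_mul, norm_pow,
    Real.norm_eq_abs, norm_iteratedDeriv_log hi hpos, Real.norm_eq_abs,
    abs_of_pos Real.two_pi_pos]
  -- `|a|^i (i-1)! (1+av)^{-i} / (2π) ≤ |a|^i · i^i · 2^i`
  have hfact : (Nat.factorial (i - 1) : ℝ) ≤ (i : ℝ) ^ i := by
    have h1 : (Nat.factorial (i - 1) : ℝ) ≤ ((i - 1 : ℕ) : ℝ) ^ (i - 1) := by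
      exact_mod_cast Nat.factorial_le_pow (i - 1)
    have h2 : ((i - 1 : ℕ) : ℝ) ^ (i - 1) ≤ (i : ℝ) ^ (i - 1) :=
      pow_le_pow_left₀ (Nat.cast_nonneg _) (by exact_mod_cast Nat.sub_le i 1) _
    have h3 : (i : ℝ) ^ (i - 1) ≤ (i : ℝ) ^ i :=
      pow_le_pow_right₀ (by exact_mod_cast hi) (Nat.sub_le i 1)
    linarith
  have hinv : ((1 + a * v) ^ i)⁻¹ ≤ (2 : ℝ) ^ i := by
    rw [← inv_pow]
    apply pow_le_pow_left₀ (by positivity)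
    rw [inv_le_comm₀ hpos (by norm_num)]
    linarith
  have hpi : (1 : ℝ) ≤ 2 * π := by linarith [Real.pi_gt_three]
  calc |a| ^ i * ((Nat.factorial (i - 1) : ℝ) * ((1 + a * v) ^ i)⁻¹) / (2 * π)
      ≤ |a| ^ i * ((Nat.factorial (i - 1) : ℝ) * ((1 + a * v) ^ i)⁻¹) / 1 := by
        gcongr
    _ = |a| ^ i * (Nat.factorial (i - 1) : ℝ) * ((1 + a * v) ^ i)⁻¹ := by ring
    _ ≤ |a| ^ i * (i : ℝ) ^ i * (2 : ℝ) ^ i := by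
        gcongr
    _ = (2 * |a| * i) ^ i := by ring

/-- `v ↦ log(1 + a v)/(2π)` is smooth on the open set `{v | 0 < 1 + a v}`. [cite: BondarenkoHeap2026, §6.2, TeX l.800–811] -/
theorem contDiffOn_log_affine (a : ℝ) :
    ContDiffOn ℝ ∞ (fun v => Real.log (1 + a * v) / (2 * π)) {v | 0 < 1 + a * v} := by
  intro v hv
  refine ContDiffAt.contDiffWithinAt ?_
  have h1 : ContDiffAt ℝ ∞ (fun v : ℝ => 1 + a * v) v := by fun_prop
  exact ((Real.contDiffAt_log.2 (ne_of_gt hv)).comp v h1).div_const _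

/-- `{v | 0 < 1 + a v}` is open. [cite: BondarenkoHeap2026, §6.2, TeX l.800–811] -/
theorem isOpen_log_affine_dom (a : ℝ) : IsOpen {v : ℝ | 0 < 1 + a * v} :=
  isOpen_lt continuous_const (by fun_prop)

/-! ### Composition bound (one-dimensional wrapper of `norm_iteratedFDerivWithin_comp_le`) -/

/-- **Faà di Bruno bound in one variable**: `g : ℝ → F` smooth, `f : ℝ → ℝ` smooth on an open set
`s ∋ x`; if `‖g⁽ⁱ⁾(f x)‖ ≤ C` (`i ≤ n`) and `‖f⁽ⁱ⁾(x)‖ ≤ Dⁱ` (`1 ≤ i ≤ n`), then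
`‖(g ∘ f)⁽ⁿ⁾(x)‖ ≤ n! · C · Dⁿ`. [cite: BondarenkoHeap2026, §6.2, TeX l.800–804] -/
theorem norm_iteratedDeriv_comp_le {g : ℝ → F} {f : ℝ → ℝ} {s : Set ℝ} (hs : IsOpen s)
    (hg : ContDiff ℝ ∞ g) (hf : ContDiffOn ℝ ∞ f s) {x : ℝ} (hx : x ∈ s) {n : ℕ} {C D : ℝ}
    (hC : ∀ i, i ≤ n → ‖iteratedDeriv i g (f x)‖ ≤ C)
    (hD : ∀ i, 1 ≤ i → i ≤ n → ‖iteratedDeriv i f x‖ ≤ D ^ i) :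
    ‖iteratedDeriv n (g ∘ f) x‖ ≤ (Nat.factorial n) * C * D ^ n := by
  have h := norm_iteratedFDerivWithin_comp_le (𝕜 := ℝ) (n := n) (N := (⊤ : ℕ∞))
    (t := Set.univ) hg.contDiffOn hf (by exact_mod_cast le_top) uniqueDiffOn_univ hs.uniqueDiffOn
    (Set.mapsTo_univ _ _) hx (C := C) (D := D) ?_ ?_
  · rw [← iteratedDerivWithin_of_isOpen hs hx, ← norm_iteratedFDerivWithin_eq_norm_iteratedDerivWithin]
    exact h
  · intro i hi
    rw [iteratedFDerivWithin_univ, norm_iteratedFDeriv_eq_norm_iteratedDeriv]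
    exact hC i hi
  · intro i hi1 hi
    rw [norm_iteratedFDerivWithin_eq_norm_iteratedDerivWithin, iteratedDerivWithin_of_isOpen hs hx]
    exact hD i hi1 hi

/-! ### The embedding `ℝ → ℂ` and iterated derivatives; compact-interval bounds -/

/-- Iterated derivatives commute with `ℝ → ℂ` for a smooth real function (copy of the private
lemma of `SmoothDyadicPartition`). [folklore] -/
private theorem iteratedDeriv_ofReal_comp {f : ℝ → ℝ} (hf : ContDiff ℝ ∞ f) (j : ℕ) (x : ℝ) :
    iteratedDeriv j (fun y : ℝ => (f y : ℂ)) x = ((iteratedDeriv j f x : ℝ) : ℂ) := by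
  induction j generalizing f x with
  | zero => simp
  | succ j ih =>
    rw [iteratedDeriv_succ', iteratedDeriv_succ']
    have hd : ∀ y, HasDerivAt f (deriv f y) y := fun y =>
      (hf.differentiable (by simp)).differentiableAt.hasDerivAt
    have hderiv : deriv (fun y : ℝ => (f y : ℂ)) = fun y => ((deriv f y : ℝ) : ℂ) := by
      funext y
      exact (hd y).ofReal_comp.deriv
    rw [hderiv]
    exact ih (contDiff_infty_iff_deriv.1 hf).2 x

/-- The iterated derivatives of a polynomial function are polynomial functions. [folklore] -/
private theorem iteratedDeriv_polynomial_eval (P : Polynomial ℝ) (i : ℕ) :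
    iteratedDeriv i (fun x => P.eval x) = fun x => (Polynomial.derivative^[i] P).eval x := by
  induction i generalizing P with
  | zero => funext x; simp
  | succ i ih =>
    have hd : deriv (fun x => P.eval x) = fun x => (Polynomial.derivative P).eval x :=
      funext fun x => Polynomial.deriv (p := P)
    rw [iteratedDeriv_succ', hd, ih]
    simp only [Function.iterate_succ, Function.comp_apply]

/-- **Each derivative of a smooth real function is bounded on a compact interval.** [folklore] -/
private theorem exists_bound_iteratedDeriv_of_contDiff {f : ℝ → ℝ} (hf : ContDiff ℝ ∞ f) (i : ℕ)
    (a b : ℝ) : ∃ C : ℝ, 0 ≤ C ∧ ∀ x ∈ Set.Icc a b, ‖iteratedDeriv i f x‖ ≤ C := by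
  have hcont : Continuous (iteratedDeriv i f) :=
    hf.continuous_iteratedDeriv i (by exact_mod_cast le_top)
  obtain ⟨C, hC⟩ := isCompact_Icc.exists_bound_of_continuousOn (hcont.continuousOn (s := Set.Icc a b))
  exact ⟨max C 0, le_max_right _ _, fun x hx => (hC x hx).trans (le_max_left _ _)⟩


/-! ### Real factors on `[1,2]`: `y^r`, `f ∘ log`, dilations -/

/-- **Power profile**: for `r ≤ 0`, `m : ℕ`, `y ≥ 1`: `‖(x ↦ x^r)⁽ᵐ⁾(y)‖ ≤ (|r| + m)ᵐ`. [folklore] -/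
private theorem norm_iteratedDeriv_rpow_le {r : ℝ} (hr : r ≤ 0) (m : ℕ) {y : ℝ} (hy : 1 ≤ y) :
    ‖iteratedDeriv m (fun x : ℝ => x ^ r) y‖ ≤ (|r| + m) ^ m := by
  rw [iteratedDeriv_eq_iterate, Real.iter_deriv_rpow_const, Real.norm_eq_abs, abs_mul,
    descPochhammer_eval_eq_prod_range, Finset.abs_prod]
  have h1 : ∏ j ∈ Finset.range m, |r - (j : ℝ)| ≤ (|r| + m) ^ m := by
    calc ∏ j ∈ Finset.range m, |r - (j : ℝ)| ≤ ∏ _j ∈ Finset.range m, (|r| + m) := by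
          refine Finset.prod_le_prod (fun j _ => abs_nonneg _) fun j hj => ?_
          rw [Finset.mem_range] at hj
          have hjm : (j : ℝ) ≤ m := by exact_mod_cast hj.le
          calc |r - (j : ℝ)| ≤ |r| + |(j : ℝ)| := abs_sub _ _
            _ = |r| + j := by rw [Nat.abs_cast]
            _ ≤ |r| + m := by linarith
      _ = (|r| + m) ^ m := by rw [Finset.prod_const, Finset.card_range]
  have h2 : |y ^ (r - m)| ≤ 1 := by
    rw [abs_of_nonneg (Real.rpow_nonneg (by linarith) _)]
    exact Real.rpow_le_one_of_one_le_of_nonpos hy (by linarith [(Nat.cast_nonneg m : (0 : ℝ) ≤ m)])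
  calc (∏ j ∈ Finset.range m, |r - (j : ℝ)|) * |y ^ (r - m)| ≤ (|r| + m) ^ m * 1 :=
        mul_le_mul h1 h2 (abs_nonneg _) (by positivity)
    _ = (|r| + m) ^ m := mul_one _

/-- **`f ∘ log` on `[1,2]`**: if `g : ℝ → F` is smooth with `‖g⁽ⁱ⁾(log y)‖ ≤ C` for `i ≤ n`, then
`‖(g ∘ log)⁽ⁿ⁾(y)‖ ≤ n! · C · (max 1 n)ⁿ` for `1 ≤ y`. [cite: BondarenkoHeap2026, §6.2, TeX l.800–804] -/
theorem norm_iteratedDeriv_comp_log_le {g : ℝ → F} (hg : ContDiff ℝ ∞ g) {y : ℝ} (hy : 1 ≤ y)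
    {n : ℕ} {C : ℝ} (hC : ∀ i, i ≤ n → ‖iteratedDeriv i g (Real.log y)‖ ≤ C) :
    ‖iteratedDeriv n (g ∘ Real.log) y‖ ≤ (Nat.factorial n) * C * (max 1 (n : ℝ)) ^ n := by
  have hy0 : 0 < y := by linarith
  refine norm_iteratedDeriv_comp_le isOpen_Ioi hg (Real.contDiffOn_log.mono fun x hx => ne_of_gt hx)
    hy0 hC fun i hi1 hi => ?_
  rw [norm_iteratedDeriv_log hi1 hy0]
  have hfact : (Nat.factorial (i - 1) : ℝ) ≤ (max 1 (n : ℝ)) ^ i := by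
    have h1 : (Nat.factorial (i - 1) : ℝ) ≤ ((i - 1 : ℕ) : ℝ) ^ (i - 1) := by
      exact_mod_cast Nat.factorial_le_pow (i - 1)
    have h2 : ((i - 1 : ℕ) : ℝ) ^ (i - 1) ≤ (max 1 (n : ℝ)) ^ (i - 1) :=
      pow_le_pow_left₀ (Nat.cast_nonneg _)
        ((show ((i - 1 : ℕ) : ℝ) ≤ n by exact_mod_cast (by omega : i - 1 ≤ n)).trans
          (le_max_right _ _)) _
    have h3 : (max 1 (n : ℝ)) ^ (i - 1) ≤ (max 1 (n : ℝ)) ^ i :=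
      pow_le_pow_right₀ (le_max_left _ _) (Nat.sub_le i 1)
    linarith
  have hyi : (y ^ i)⁻¹ ≤ 1 := inv_le_one_of_one_le₀ (one_le_pow₀ hy)
  calc (Nat.factorial (i - 1) : ℝ) * (y ^ i)⁻¹ ≤ (max 1 (n : ℝ)) ^ i * 1 :=
        mul_le_mul hfact hyi (by positivity) (by positivity)
    _ = (max 1 (n : ℝ)) ^ i := mul_one _

/-- A function of `log(X·y)` agrees near `y > 0` with the corresponding function of `log X + log y`.
[folklore] -/
private theorem eventuallyEq_comp_log_mul {E : Type*} (g : ℝ → E) {X y : ℝ} (hX : 0 < X) (hy : 0 < y) :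
    (fun y : ℝ => g (Real.log (X * y))) =ᶠ[𝓝 y] fun y => g (Real.log X + Real.log y) := by
  filter_upwards [Ioi_mem_nhds hy] with z hz
  rw [Real.log_mul hX.ne' (ne_of_gt hz)]

/-- **Polynomial of `log(Xy)/log L`**: uniform derivative bounds on `[1,2]`. If `1 ≤ Lg`
(read `Lg = log L`), `−Lg ≤ log X` and `log X + log 2 ≤ W · Lg`, then the argument
`(log X + log y)/Lg` stays in `[−1, max W 1]` for `y ∈ [1,2]` and the `n`-th derivative of
`y ↦ P(log(Xy)/Lg)` at `y ∈ [1,2]` is bounded by `n! · (Σ_{i≤n} sup_{[−1, max W 1]}|P⁽ⁱ⁾|) · (max 1 n)ⁿ`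
(packaged with existential constants depending on `P, W` only). [folklore] -/
private theorem exists_bound_iteratedDeriv_polynomial_log (P : Polynomial ℝ) (W : ℝ) :
    ∃ c : ℕ → ℝ, (∀ n, 0 ≤ c n) ∧ ∀ (Lg X : ℝ), 1 ≤ Lg → 0 < X → -Lg ≤ Real.log X →
      Real.log X + Real.log 2 ≤ W * Lg →
      ∀ (n : ℕ), ∀ y ∈ Set.Icc (1 : ℝ) 2,
        ‖iteratedDeriv n (fun y : ℝ => P.eval (Real.log (X * y) / Lg)) y‖ ≤ c n := by
  have hPs : ContDiff ℝ ∞ (fun x : ℝ => P.eval x) := by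
    simpa only [Polynomial.coe_aeval_eq_eval] using P.contDiff_aeval (𝕜 := ℝ) ∞
  -- bounds for the derivatives of `P` on `[-1, max W 1]`
  have hex : ∀ i : ℕ, ∃ C : ℝ, 0 ≤ C ∧ ∀ w ∈ Set.Icc (-1 : ℝ) (max W 1),
      ‖iteratedDeriv i (fun x => P.eval x) w‖ ≤ C :=
    fun i => exists_bound_iteratedDeriv_of_contDiff hPs i (-1) (max W 1)
  choose C hC0 hC using hex
  -- monotone envelope
  set C' : ℕ → ℝ := fun n => ∑ i ∈ Finset.range (n + 1), C i with hC'
  have hC'ge : ∀ {i n : ℕ}, i ≤ n → C i ≤ C' n := by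
    intro i n hin
    simp only [hC']
    exact Finset.single_le_sum (f := C) (fun j _ => hC0 j) (Finset.mem_range.2 (by omega))
  have hC'0 : ∀ n, 0 ≤ C' n := fun n => Finset.sum_nonneg fun i _ => hC0 i
  refine ⟨fun n => (Nat.factorial n) * C' n * (max 1 (n : ℝ)) ^ n, fun n =>
    mul_nonneg (mul_nonneg (Nat.cast_nonneg _) (hC'0 n))
      (pow_nonneg (zero_le_one.trans (le_max_left _ _)) _), ?_⟩
  intro Lg X hLg hX hXlo hXhi n y hy
  have hy0 : 0 < y := by linarith [hy.1]
  have hLg0 : 0 < Lg := by linarith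
  -- rewrite near `y` as `g (log y)` with `g z = P.eval ((log X + z)/Lg)`
  set g : ℝ → ℝ := fun z => P.eval ((Real.log X + z) / Lg) with hg
  have hev : (fun y : ℝ => P.eval (Real.log (X * y) / Lg)) =ᶠ[𝓝 y] (g ∘ Real.log) :=
    eventuallyEq_comp_log_mul (fun z => P.eval (z / Lg)) hX hy0
  rw [hev.iteratedDeriv_eq n]
  have hgs : ContDiff ℝ ∞ g := by
    simp only [hg]
    exact hPs.comp (by fun_prop)
  refine norm_iteratedDeriv_comp_log_le hgs hy.1 fun i hi => ?_
  -- `g⁽ⁱ⁾(z) = Lg^{-i} · P⁽ⁱ⁾((log X + z)/Lg)`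
  have hgaff : g = fun z => (fun x => P.eval x) (Real.log X / Lg + Lg⁻¹ * z) := by
    funext z; simp only [hg]; ring_nf
  rw [hgaff, iteratedDeriv_comp_const_add_mul (fun x => P.eval x) (Real.log X / Lg) Lg⁻¹ i,
    norm_smul, norm_pow, norm_inv, Real.norm_eq_abs, abs_of_pos hLg0]
  have hw : Real.log X / Lg + Lg⁻¹ * Real.log y ∈ Set.Icc (-1 : ℝ) (max W 1) := by
    have hlogy0 : 0 ≤ Real.log y := Real.log_nonneg hy.1
    have hlogy2 : Real.log y ≤ Real.log 2 := Real.log_le_log hy0 hy.2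
    have heq : Real.log X / Lg + Lg⁻¹ * Real.log y = (Real.log X + Real.log y) / Lg := by
      field_simp
    rw [heq, Set.mem_Icc]
    constructor
    · rw [le_div_iff₀ hLg0]; linarith
    · rw [div_le_iff₀ hLg0]
      have := le_max_left W 1
      nlinarith
  have hPi := hC i _ hw
  have hLgi : Lg⁻¹ ^ i ≤ 1 := pow_le_one₀ (inv_nonneg.2 hLg0.le) (inv_le_one_of_one_le₀ hLg)
  calc Lg⁻¹ ^ i * ‖iteratedDeriv i (fun x => P.eval x) (Real.log X / Lg + Lg⁻¹ * Real.log y)‖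
      ≤ 1 * C i := mul_le_mul hLgi hPi (norm_nonneg _) zero_le_one
    _ ≤ C' n := by rw [one_mul]; exact hC'ge hi

/-- **Dilated profile**: `‖(y ↦ f(a y))⁽ᵐ⁾(y)‖ = |a|ᵐ ‖f⁽ᵐ⁾(a y)‖`. [folklore] -/
private theorem norm_iteratedDeriv_comp_mul (f : ℝ → F) (a : ℝ) (m : ℕ) (y : ℝ) :
    ‖iteratedDeriv m (fun y => f (a * y)) y‖ = |a| ^ m * ‖iteratedDeriv m f (a * y)‖ := by
  rw [iteratedDeriv_comp_mul_left f a m]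
  simp only [norm_smul, norm_pow, Real.norm_eq_abs]

end Calculus


/-! ### The cut-off `bump²` and the generic `[1,2]`-profile `bump(y)² · F(y) · y^{−1/2}` -/

section Profile

/-- `bump²` vanishes off `[1,2]`. [cite: BondarenkoHeap2026, §6.2, TeX l.750–753] -/
theorem bump_sq_ne_zero_imp {y : ℝ} (h : bump y ^ 2 ≠ 0) : 1 ≤ y ∧ y ≤ 2 := by
  have h' := bump_ne_zero_imp (pow_ne_zero_iff two_ne_zero |>.1 h)
  exact ⟨h'.1.le, h'.2.le⟩

/-- `0 ≤ bump² ≤ 1`. [cite: BondarenkoHeap2026, §6.2, TeX l.750–753] -/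
theorem bump_sq_le_one (y : ℝ) : bump y ^ 2 ≤ 1 := by
  have h0 := bump_nonneg y
  have h1 := bump_le_one y
  nlinarith

/-- `bump²` is smooth. [cite: BondarenkoHeap2026, §6.2, TeX l.750–753] -/
theorem bump_sq_contDiff : ContDiff ℝ ∞ fun y => bump y ^ 2 := bump_contDiff.pow 2

/-- **One family of bounds for all derivatives of `bump²`** (Leibniz on `ω·ω`), with the order-`0`
constant equal to `1`. [cite: BondarenkoHeap2026, §6.2, TeX l.834–836] -/
theorem exists_family_bump_sq : ∃ b : ℕ → ℝ, (∀ n, 0 ≤ b n) ∧ b 0 = 1 ∧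
    ∀ (n : ℕ) (y : ℝ), ‖iteratedDeriv n (fun y => bump y ^ 2) y‖ ≤ b n := by
  choose β hβ0 hβ using exists_bound_iteratedDeriv_bump
  refine ⟨fun n => if n = 0 then 1 else ∑ i ∈ Finset.range (n + 1), (n.choose i : ℝ) * β i * β (n - i),
    fun n => ?_, by simp, fun n y => ?_⟩
  · by_cases hn : n = 0
    · simp [hn]
    · simp only [hn, if_false]
      exact Finset.sum_nonneg fun i _ => mul_nonneg (mul_nonneg (Nat.cast_nonneg _) (hβ0 _)) (hβ0 _)
  · by_cases hn : n = 0
    · subst hn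
      simp only [if_true, iteratedDeriv_zero, Real.norm_eq_abs]
      rw [abs_of_nonneg (sq_nonneg _)]
      exact bump_sq_le_one y
    · simp only [hn, if_false]
      have hsq : (fun y => bump y ^ 2) = fun y => bump y * bump y := by funext y; ring
      rw [hsq]
      exact norm_iteratedDeriv_mul_le (bump_contDiff.contDiffAt.of_le (by exact_mod_cast le_top))
        (bump_contDiff.contDiffAt.of_le (by exact_mod_cast le_top)) (fun i _ => hβ i y)
        (fun i _ => hβ i y)

/-- **The generic profile**: for `F : ℝ → ℝ` smooth at the points of `[1,2]` with
`‖F⁽ⁱ⁾‖ ≤ cᵢ` on `[1,2]` (all `i`), the function `y ↦ bump(y)² · (F(y) · y^{−1/2})` is smooth on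
`ℝ` and ALL its derivatives are bounded by constants `Bₙ` depending only on `c`.
[cite: BondarenkoHeap2026, §6.2, TeX l.834–836] -/
theorem exists_profile_family {c : ℕ → ℝ} (hc0 : ∀ i, 0 ≤ c i) :
    ∃ B : ℕ → ℝ, (∀ n, 0 ≤ B n) ∧ ∀ F : ℝ → ℝ, (∀ y ∈ Set.Icc (1 : ℝ) 2, ContDiffAt ℝ ∞ F y) →
      (∀ (i : ℕ), ∀ y ∈ Set.Icc (1 : ℝ) 2, ‖iteratedDeriv i F y‖ ≤ c i) →
      ContDiff ℝ ∞ (fun y => bump y ^ 2 * (F y * y ^ (-(1 / 2 : ℝ)))) ∧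
        ∀ (n : ℕ) (y : ℝ), ‖iteratedDeriv n (fun y => bump y ^ 2 * (F y * y ^ (-(1 / 2 : ℝ)))) y‖ ≤ B n := by
  obtain ⟨b, hb0, -, hb⟩ := exists_family_bump_sq
  -- bounds for `F · y^{-1/2}` on `[1,2]`
  set c' : ℕ → ℝ := fun m => ∑ l ∈ Finset.range (m + 1), (m.choose l : ℝ) * c l *
    (|(-(1 / 2 : ℝ))| + ((m - l : ℕ) : ℝ)) ^ (m - l) with hc'
  have hc'0 : ∀ m, 0 ≤ c' m := fun m =>
    Finset.sum_nonneg fun l _ => mul_nonneg (mul_nonneg (Nat.cast_nonneg _) (hc0 l)) (by positivity)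
  refine ⟨fun n => ∑ i ∈ Finset.range (n + 1), (n.choose i : ℝ) * b i * c' (n - i), fun n =>
    Finset.sum_nonneg fun i _ => mul_nonneg (mul_nonneg (Nat.cast_nonneg _) (hb0 i)) (hc'0 _), ?_⟩
  intro F hF hFc
  have hG : ∀ y ∈ Set.Icc (1 : ℝ) 2, ContDiffAt ℝ ∞ (fun y => F y * y ^ (-(1 / 2 : ℝ))) y := by
    intro y hy
    exact (hF y hy).mul (Real.contDiffAt_rpow_const_of_ne (by linarith [hy.1]))
  have hGc : ∀ (m : ℕ), ∀ y ∈ Set.Icc (1 : ℝ) 2,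
      ‖iteratedDeriv m (fun y => F y * y ^ (-(1 / 2 : ℝ))) y‖ ≤ c' m := by
    intro m y hy
    exact norm_iteratedDeriv_mul_le ((hF y hy).of_le (by exact_mod_cast le_top))
      ((Real.contDiffAt_rpow_const_of_ne (by linarith [hy.1])).of_le (by exact_mod_cast le_top))
      (fun i _ => hFc i y hy) (fun i _ => norm_iteratedDeriv_rpow_le (by norm_num) i hy.1)
  refine ⟨contDiff_mul_of_support bump_sq_contDiff (fun y hy => bump_sq_ne_zero_imp hy) hG,
    fun n y => ?_⟩
  exact norm_iteratedDeriv_mul_le_of_support bump_sq_contDiff (fun y hy => bump_sq_ne_zero_imp hy) hG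
    (fun i y => hb i y) (fun i _ y hy => hGc i y hy) hc'0 y

/-- Norms of iterated derivatives are unchanged by the embedding `ℝ → ℂ` (smooth real function).
[folklore] -/
private theorem norm_iteratedDeriv_ofReal {Φ : ℝ → ℝ} (hΦ : ContDiff ℝ ∞ Φ) (n : ℕ) (y : ℝ) :
    ‖iteratedDeriv n (fun y => (Φ y : ℂ)) y‖ = ‖iteratedDeriv n Φ y‖ := by
  rw [iteratedDeriv_ofReal_comp hΦ, Complex.norm_real]

end Profile

/-! ### The three real inner factors: `G₀(log(Xy)/log L)·f₀(Xy/L)` and the `sinc` factor -/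

section Factors

/-- `log L ≥ 1` once `q ≥ 2` (`L = q^{17/6} ≥ 2^{17/6} > e`). [cite: BondarenkoHeap2026, §2.3 (5) p. 8] -/
theorem one_le_log_lengthL {q : ℕ} (hq : 2 ≤ q) : 1 ≤ Real.log (lengthL q) := by
  have hq2 : (2 : ℝ) ≤ q := by exact_mod_cast hq
  rw [lengthL, Real.log_rpow (by linarith)]
  have h2 : Real.log 2 ≤ Real.log q := Real.log_le_log two_pos hq2
  have := Real.log_two_gt_d9
  nlinarith

/-- `log 2 ≤ log L` once `q ≥ 2`. [cite: BondarenkoHeap2026, §2.3 (5) p. 8] -/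
theorem log_two_le_log_lengthL {q : ℕ} (hq : 2 ≤ q) : Real.log 2 ≤ Real.log (lengthL q) := by
  have hq2 : (2 : ℝ) ≤ q := by exact_mod_cast hq
  rw [lengthL, Real.log_rpow (by linarith)]
  have h2 : Real.log 2 ≤ Real.log q := Real.log_le_log two_pos hq2
  have := Real.log_two_gt_d9
  nlinarith

/-- `0 < L`. [cite: BondarenkoHeap2026, §2.3 (5) p. 8] -/
theorem lengthL_pos {q : ℕ} (hq : 1 ≤ q) : 0 < lengthL q := by
  have : (1 : ℝ) ≤ q := by exact_mod_cast hq
  unfold lengthL; positivity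

/-- The `G`-factor `y ↦ G₀(log(Ny)/log L) · f₀(Ny/L)` is smooth at every `y > 0` (`N > 0`).
[cite: BondarenkoHeap2026, §2.3 p. 8 (G(n))] -/
theorem contDiffAt_Gfactor (ρ : Resonator) (q : ℕ) {N : ℝ} (hN : 0 < N) {y : ℝ} (hy : 0 < y) :
    ContDiffAt ℝ ∞
      (fun y => ρ.G₀.eval (Real.log (N * y) / Real.log (lengthL q)) * ρ.f₀ (N * y / lengthL q)) y := by
  have hPs : ContDiff ℝ ∞ (fun x : ℝ => ρ.G₀.eval x) := by
    simpa only [Polynomial.coe_aeval_eq_eval] using ρ.G₀.contDiff_aeval (𝕜 := ℝ) ∞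
  have h1 : ContDiffAt ℝ ∞ (fun y : ℝ => Real.log (N * y) / Real.log (lengthL q)) y :=
    ((Real.contDiffAt_log.2 (by positivity)).comp y (by fun_prop)).div_const _
  exact (hPs.contDiffAt.comp y h1).mul
    ((ρ.f₀_smooth.comp (by fun_prop : ContDiff ℝ ∞ fun y : ℝ => N * y / lengthL q)).contDiffAt)

/-- **The `G`-factor `y ↦ G₀(log(Ny)/log L) · f₀(Ny/L)`**: smooth at the points of `[1,2]` and, for
`q ≥ 2`, `1/2 ≤ N ≤ C_N · L`, with ALL derivatives on `[1,2]` bounded by constants depending only on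
`(ρ, C_N)`. [cite: BondarenkoHeap2026, §6.2, TeX l.785–795 and l.834–836] -/
theorem exists_family_Gfactor (ρ : Resonator) {CN : ℝ} (hCN : 0 < CN) :
    ∃ c : ℕ → ℝ, (∀ i, 0 ≤ c i) ∧ ∀ (q : ℕ), 2 ≤ q → ∀ (N : ℝ), 2⁻¹ ≤ N → N ≤ CN * lengthL q →
      (∀ y ∈ Set.Icc (1 : ℝ) 2, ContDiffAt ℝ ∞
        (fun y => ρ.G₀.eval (Real.log (N * y) / Real.log (lengthL q)) * ρ.f₀ (N * y / lengthL q)) y) ∧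
      ∀ (i : ℕ), ∀ y ∈ Set.Icc (1 : ℝ) 2,
        ‖iteratedDeriv i (fun y => ρ.G₀.eval (Real.log (N * y) / Real.log (lengthL q)) *
          ρ.f₀ (N * y / lengthL q)) y‖ ≤ c i := by
  -- polynomial-of-log part
  obtain ⟨cP, hcP0, hcP⟩ := exists_bound_iteratedDeriv_polynomial_log ρ.G₀ (1 + |Real.log (2 * CN)|)
  -- `f₀` part: bounds of `f₀⁽ⁱ⁾` on `[0, 2 max(1,C_N)]`
  have hex : ∀ i : ℕ, ∃ C : ℝ, 0 ≤ C ∧ ∀ x ∈ Set.Icc (0 : ℝ) (2 * max 1 CN),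
      ‖iteratedDeriv i ρ.f₀ x‖ ≤ C :=
    fun i => exists_bound_iteratedDeriv_of_contDiff ρ.f₀_smooth i 0 (2 * max 1 CN)
  choose Cf hCf0 hCf using hex
  set cf : ℕ → ℝ := fun i => (max 1 CN) ^ i * Cf i with hcf
  have hcf0 : ∀ i, 0 ≤ cf i := fun i =>
    mul_nonneg (pow_nonneg (zero_le_one.trans (le_max_left _ _)) _) (hCf0 i)
  refine ⟨fun n => ∑ i ∈ Finset.range (n + 1), (n.choose i : ℝ) * cP i * cf (n - i), fun n =>
    Finset.sum_nonneg fun i _ => mul_nonneg (mul_nonneg (Nat.cast_nonneg _) (hcP0 i)) (hcf0 _), ?_⟩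
  intro q hq N hN hNL
  set L := lengthL q with hL
  have hL0 : 0 < L := lengthL_pos (by omega)
  have hlogL : 1 ≤ Real.log L := one_le_log_lengthL hq
  have hN0 : 0 < N := by linarith
  have hPs : ContDiff ℝ ∞ (fun x : ℝ => ρ.G₀.eval x) := by
    simpa only [Polynomial.coe_aeval_eq_eval] using ρ.G₀.contDiff_aeval (𝕜 := ℝ) ∞
  -- smoothness of the two factors at `y ∈ [1,2]`
  have hA : ∀ y ∈ Set.Icc (1 : ℝ) 2,
      ContDiffAt ℝ ∞ (fun y => ρ.G₀.eval (Real.log (N * y) / Real.log L)) y := by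
    intro y hy
    have hy0 : 0 < y := by linarith [hy.1]
    have h1 : ContDiffAt ℝ ∞ (fun y : ℝ => Real.log (N * y) / Real.log L) y :=
      ((Real.contDiffAt_log.2 (by positivity)).comp y (by fun_prop)).div_const _
    exact hPs.contDiffAt.comp y h1
  have hB : ∀ y : ℝ, ContDiffAt ℝ ∞ (fun y => ρ.f₀ (N * y / L)) y := fun y =>
    (ρ.f₀_smooth.comp (by fun_prop : ContDiff ℝ ∞ fun y : ℝ => N * y / L)).contDiffAt
  refine ⟨fun y hy => (hA y hy).mul (hB y), fun i y hy => ?_⟩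
  have hy0 : 0 < y := by linarith [hy.1]
  -- bounds for the factors
  have hAc : ∀ j, j ≤ i → ‖iteratedDeriv j (fun y => ρ.G₀.eval (Real.log (N * y) / Real.log L)) y‖ ≤ cP j := by
    intro j _
    refine hcP (Real.log L) N hlogL hN0 ?_ ?_ j y hy
    · have h2 : Real.log 2⁻¹ ≤ Real.log N := Real.log_le_log (by norm_num) hN
      rw [Real.log_inv] at h2
      linarith [log_two_le_log_lengthL hq]
    · have h1 : Real.log N ≤ Real.log (CN * L) := Real.log_le_log hN0 hNL
      rw [Real.log_mul hCN.ne' hL0.ne'] at h1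
      have h3 : Real.log CN + Real.log 2 = Real.log (2 * CN) := by
        rw [Real.log_mul two_ne_zero hCN.ne']; ring
      have h4 : Real.log (2 * CN) ≤ |Real.log (2 * CN)| * Real.log L := by
        calc Real.log (2 * CN) ≤ |Real.log (2 * CN)| := le_abs_self _
          _ = |Real.log (2 * CN)| * 1 := (mul_one _).symm
          _ ≤ |Real.log (2 * CN)| * Real.log L :=
              mul_le_mul_of_nonneg_left hlogL (abs_nonneg _)
      nlinarith
  have hBc : ∀ j, j ≤ i → ‖iteratedDeriv j (fun y => ρ.f₀ (N * y / L)) y‖ ≤ cf j := by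
    intro j _
    have heq : (fun y => ρ.f₀ (N * y / L)) = fun y => ρ.f₀ ((N / L) * y) := by
      funext z; ring_nf
    rw [heq, norm_iteratedDeriv_comp_mul ρ.f₀ (N / L) j y]
    have hNL' : N / L ≤ CN := by rw [div_le_iff₀ hL0]; exact hNL
    have hNL0 : 0 ≤ N / L := by positivity
    have hx : N / L * y ∈ Set.Icc (0 : ℝ) (2 * max 1 CN) := by
      constructor
      · positivity
      · calc N / L * y ≤ CN * 2 := mul_le_mul hNL' hy.2 hy0.le hCN.le
          _ ≤ 2 * max 1 CN := by linarith [le_max_right 1 CN]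
    rw [abs_of_nonneg hNL0]
    simp only [hcf]
    exact mul_le_mul (pow_le_pow_left₀ hNL0 (hNL'.trans (le_max_right _ _)) j) (hCf j _ hx)
      (norm_nonneg _) (by positivity)
  exact norm_iteratedDeriv_mul_le ((hA y hy).of_le (by exact_mod_cast le_top))
    ((hB y).of_le (by exact_mod_cast le_top)) hAc hBc

/-- **The `sinc` factor `y ↦ sin(h·log(Ky)/2)/log(Ky)`** (`h = 2πc/log T`, the paper's `g_h`
transported to the dyadic variable): near `[1,2]` (for `K ≥ √2`) it equals
`(h/2)·sinc(h·log(Ky)/2)`, hence is smooth there with ALL derivatives on `[1,2]` bounded by constants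
depending only on `c`, uniformly in `T ≥ 2` and `K ≥ √2`.
[cite: BondarenkoHeap2026, Proposition 1 p. 7 (g_h) and §6.2, TeX l.834–836] -/
theorem exists_family_sincFactor {c : ℝ} (hc : 0 < c) :
    ∃ cα : ℕ → ℝ, (∀ i, 0 ≤ cα i) ∧ ∀ (T : ℝ), 2 ≤ T → ∀ (K : ℝ), Real.sqrt 2 ≤ K →
      (∀ y ∈ Set.Icc (1 : ℝ) 2, ContDiffAt ℝ ∞
        (fun y => Real.sin (gapWidth c T * Real.log (K * y) / 2) / Real.log (K * y)) y) ∧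
      (∀ y ∈ Set.Icc (1 : ℝ) 2,
        |Real.sin (gapWidth c T * Real.log (K * y) / 2) / Real.log (K * y)| ≤ π * c / Real.log 2) ∧
      ∀ (i : ℕ), ∀ y ∈ Set.Icc (1 : ℝ) 2,
        ‖iteratedDeriv i (fun y => Real.sin (gapWidth c T * Real.log (K * y) / 2) / Real.log (K * y)) y‖
          ≤ cα i := by
  set κ : ℝ := max 1 (π * c / Real.log 2) with hκ
  have hκ1 : 1 ≤ κ := le_max_left _ _
  refine ⟨fun n => (Nat.factorial n) * κ ^ (n + 1) * (max 1 (n : ℝ)) ^ n, fun n => by positivity, ?_⟩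
  intro T hT K hK
  have hs2 : 1 < Real.sqrt 2 := Real.one_lt_sqrt_two
  have hK1 : 1 < K := lt_of_lt_of_le hs2 hK
  have hK0 : 0 < K := by linarith
  have hlog2 : 0 < Real.log 2 := Real.log_pos one_lt_two
  have hlogT : Real.log 2 ≤ Real.log T := Real.log_le_log two_pos hT
  have hlogT0 : 0 < Real.log T := lt_of_lt_of_le hlog2 hlogT
  set h : ℝ := gapWidth c T with hh
  have hh0 : 0 < h := by rw [hh, gapWidth]; positivity
  have hhle : h / 2 ≤ π * c / Real.log 2 := by
    have heq : h / 2 = π * c / Real.log T := by rw [hh, gapWidth]; ring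
    rw [heq]
    exact div_le_div_of_nonneg_left (by positivity) hlog2 hlogT
  have hh2κ : h / 2 ≤ κ := hhle.trans (le_max_right _ _)
  -- the smooth model `g z = (h/2) sinc ((h/2)(log K + z))`
  set g : ℝ → ℝ := fun z => h / 2 * Real.sinc (h / 2 * Real.log K + h / 2 * z) with hg
  have hgs : ContDiff ℝ ∞ g := by
    simp only [hg]
    exact contDiff_const.mul (Literature.Analysis.Fourier.contDiff_sinc.comp (by fun_prop))
  have hev : ∀ y ∈ Set.Icc (1 : ℝ) 2,
      (fun y => Real.sin (h * Real.log (K * y) / 2) / Real.log (K * y)) =ᶠ[𝓝 y] (g ∘ Real.log) := by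
    intro y hy
    have hy0 : 0 < y := by linarith [hy.1]
    have hKy : K⁻¹ < y := lt_of_lt_of_le (inv_lt_one_of_one_lt₀ hK1) hy.1
    filter_upwards [Ioi_mem_nhds hKy] with z hz
    have hz0 : 0 < z := lt_trans (inv_pos.2 hK0) hz
    have hKz : 1 < K * z := by rw [mul_comm]; exact (inv_lt_iff_one_lt_mul₀ hK0).1 hz
    have hlogKz : Real.log (K * z) ≠ 0 := (Real.log_pos hKz).ne'
    simp only [Function.comp_apply, hg]
    rw [Real.log_mul hK0.ne' hz0.ne'] at hlogKz ⊢
    rw [Real.sinc_of_ne_zero (by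
      intro h0
      apply hlogKz
      have : h / 2 * (Real.log K + Real.log z) = 0 := by linarith
      rcases mul_eq_zero.1 this with h1 | h1
      · linarith
      · exact h1)]
    field_simp
  have hderiv : ∀ (i : ℕ) (z : ℝ), ‖iteratedDeriv i g z‖ ≤ κ ^ (i + 1) := by
    intro i z
    have heq : g = fun z => h / 2 * (fun z => Real.sinc (h / 2 * Real.log K + h / 2 * z)) z := rfl
    rw [heq, iteratedDeriv_const_mul_field,
      iteratedDeriv_comp_const_add_mul Real.sinc (h / 2 * Real.log K) (h / 2) i z,
      norm_mul, norm_smul, norm_pow]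
    simp only [Real.norm_eq_abs]
    rw [abs_of_pos (half_pos hh0)]
    have hsinc := Literature.Analysis.Fourier.abs_iteratedDeriv_sinc_le i (h / 2 * Real.log K + h / 2 * z)
    have h2 : 0 ≤ h / 2 := (half_pos hh0).le
    calc h / 2 * ((h / 2) ^ i * |iteratedDeriv i Real.sinc (h / 2 * Real.log K + h / 2 * z)|)
        ≤ κ * (κ ^ i * 1) := by
          refine mul_le_mul hh2κ (mul_le_mul (pow_le_pow_left₀ h2 hh2κ i) hsinc (abs_nonneg _)
            (by positivity)) (by positivity) (by positivity)
      _ = κ ^ (i + 1) := by ring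
  refine ⟨fun y hy => ?_, fun y hy => ?_, fun i y hy => ?_⟩
  · have hy0 : 0 < y := by linarith [hy.1]
    exact (hgs.contDiffAt.comp y (Real.contDiffAt_log.2 hy0.ne')).congr_of_eventuallyEq (hev y hy)
  · have hy0 : 0 < y := by linarith [hy.1]
    have hKy : 1 < K * y := by nlinarith [hy.1]
    have hw : 0 < Real.log (K * y) := Real.log_pos hKy
    rw [abs_div, abs_of_pos hw, div_le_iff₀ hw]
    calc |Real.sin (h * Real.log (K * y) / 2)| ≤ |h * Real.log (K * y) / 2| := Real.abs_sin_le_abs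
      _ = h / 2 * Real.log (K * y) := by rw [abs_of_pos (by positivity)]; ring
      _ ≤ π * c / Real.log 2 * Real.log (K * y) := mul_le_mul_of_nonneg_right hhle hw.le
  · rw [(hev y hy).iteratedDeriv_eq i]
    refine (norm_iteratedDeriv_comp_log_le hgs hy.1 (C := κ ^ (i + 1)) fun j hj =>
      (hderiv j _).trans (pow_le_pow_right₀ hκ1 (by omega))).trans ?_
    exact le_of_eq rfl

end Factors

end OffDiagKernels

open OffDiagKernels

/-! ## (K1) The `y`-side profile `V_N` and the `u`-side kernel `W_{U,t}` -/

section Defs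

/-- **The `y`-side profile of the §6.2 separation** (our reading of TeX l.785–811, with the fourth
partition of unity in `n = km + sr`, `n ≍ N`): for `y = n/N ∈ [1,2]`,
`V_N(y) = ω(y)² · G₀(log(Ny)/log L) · f₀(Ny/L) · y^{−1/2}`, so that `G(n) n^{−1/2} ω(n/N)² =
N^{−1/2} V_N(n/N)` (`odV_id`); complex-valued so that the landed `[1,2]`-Mellin toolkit applies.
[cite: BondarenkoHeap2026, §6.2, TeX l.785–811] -/
def odV (ρ : Resonator) (q : ℕ) (N : ℝ) : ℝ → ℂ := fun y =>
  ((bump y ^ 2 * ρ.G₀.eval (Real.log (N * y) / Real.log (lengthL q)) * ρ.f₀ (N * y / lengthL q) *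
    y ^ (-(1 / 2 : ℝ)) : ℝ) : ℂ)

/-- **The `u`-side kernel of the §6.2 separation** (our reading of TeX l.795–832, with the fifth
partition of unity in `u = r/(km) ≍ U`): for `v = u/U ∈ [1,2]`,
`W_{U,t}(v) = ω(v)² · Ŵ_T(log(1 + sUv)/2π)/T · (1 + sUv)^{−it}` — the factor `(1+su)^{−it}`
produced by the `n`-inversion (`n/N = (km/N)(1+su)`) is EXPLICIT, so no differentiation under an
integral sign is needed ("differentiating `(K/x)^{s₁}` … gives a factor of `−s₁`", l.810).
`Ŵ_T` enters as the complex Fourier transform `𝓕W_T` (`= (Ŵ_T : ℂ)`, `weightHat_eq`).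
[cite: BondarenkoHeap2026, §6.2, TeX l.795–832] -/
def odW (w : Bump) (B : ℕ) (T U : ℝ) (s : ℤ) (t : ℝ) : ℝ → ℂ := fun v =>
  ((bump v ^ 2 : ℝ) : ℂ) *
    (𝓕 (fun τ : ℝ => (weight w B T τ : ℂ)) (Real.log (1 + s * U * v) / (2 * π)) / (T : ℂ)) *
    ((1 + s * U * v : ℝ) : ℂ) ^ (-(t * I))

/-- Normaliser of the `k`-weight: `max(1, πc/log 2) ≥ sup |g_h|` for `T ≥ 2` (`|g_h| ≤ h/2 = πc/log T`).
[cite: BondarenkoHeap2026, Proposition 1 p. 7 (g_h)] -/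
def nA (c : ℝ) : ℝ := max 1 (π * c / Real.log 2)

/-- **Profile of the separated `k`-weight**: `ω(y)² · (sin(h log(Ky)/2)/log(Ky)) · y^{−1/2}/n_A`
(`h = 2πc/log T`; the paper's `g_h(k) k^{−1/2}` transported to `y = k/K` and cut off dyadically).
[cite: BondarenkoHeap2026, Proposition 1 p. 7 (g_h) and §6.2, TeX l.834–836] -/
def odAlphaProfile (c T K : ℝ) : ℝ → ℂ := fun y =>
  ((bump y ^ 2 * (Real.sin (gapWidth c T * Real.log (K * y) / 2) / Real.log (K * y)) *
    y ^ (-(1 / 2 : ℝ)) / nA c : ℝ) : ℂ)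

/-- **The separated `k`-weight** `α(x) = profile(x/K) · (x/K)^{−z}` — a separated weight in the
sense of `MellinSeparatedWeights` ("`(K/x)^{s₁}` … derivatives bounded by `q^ε`", TeX l.808–811).
[cite: BondarenkoHeap2026, §6.2, TeX l.808–811 and l.834–836] -/
def odAlpha (c T K : ℝ) (z : ℂ) : ℝ → ℂ := fun x =>
  odAlphaProfile c T K (x / K) * (((x / K : ℝ)) : ℂ) ^ (-z)

/-- Normaliser of the `m`-weight: `max(1, Σᵢ |G₀,ᵢ| 2ⁱ) ≥ sup_{|w| ≤ 2} |G₀(w)| ≥ sup |G|`.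
[cite: BondarenkoHeap2026, §2.3 p. 8 (G(n))] -/
def nB (ρ : Resonator) : ℝ :=
  max 1 (∑ i ∈ Finset.range (ρ.G₀.natDegree + 1), |ρ.G₀.coeff i| * 2 ^ i)

/-- **Profile of the separated `m`-weight**: `ω(y)² · G₀(log(My)/log L) · f₀(My/L) · y^{−1/2}/n_B`
(`= V_M(y)/n_B`). [cite: BondarenkoHeap2026, §2.3 p. 8 (G(n)) and §6.2, TeX l.834–836] -/
def odBetaProfile (ρ : Resonator) (q : ℕ) (M : ℝ) : ℝ → ℂ := fun y =>
  ((bump y ^ 2 * ρ.G₀.eval (Real.log (M * y) / Real.log (lengthL q)) * ρ.f₀ (M * y / lengthL q) *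
    y ^ (-(1 / 2 : ℝ)) / nB ρ : ℝ) : ℂ)

/-- **The separated `m`-weight** `β(x) = profile(x/M) · (x/M)^{−z}`.
[cite: BondarenkoHeap2026, §6.2, TeX l.808–811 and l.834–836] -/
def odBeta (ρ : Resonator) (q : ℕ) (M : ℝ) (z : ℂ) : ℝ → ℂ := fun x =>
  odBetaProfile ρ q M (x / M) * (((x / M : ℝ)) : ℂ) ^ (-z)

end Defs

/-! ### (K1) The rewriting identities at integer points -/

section Identities

/-- `N^{−1/2} · (n/N)^{−1/2} = 1/√n`. [folklore] -/
private theorem rpow_scale_eq_inv_sqrt {n N : ℝ} (hn : 0 < n) (hN : 0 < N) :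
    N ^ (-(1 / 2 : ℝ)) * (n / N) ^ (-(1 / 2 : ℝ)) = (Real.sqrt n)⁻¹ := by
  rw [Real.div_rpow hn.le hN.le, Real.sqrt_eq_rpow, Real.rpow_neg hn.le, Real.rpow_neg hN.le]
  have h1 : 0 < N ^ (1 / 2 : ℝ) := Real.rpow_pos_of_pos hN _
  field_simp

/-- **(V-id)** `G(n) n^{−1/2} ω(n/N)² = N^{−1/2} V_N(n/N)` for `n ≥ 1`, `N > 0`.
[cite: BondarenkoHeap2026, §6.2, TeX l.785–811] -/
theorem odV_id (ρ : Resonator) (q : ℕ) {n : ℕ} (hn : 1 ≤ n) {N : ℝ} (hN : 0 < N) :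
    ((ρ.G q n / Real.sqrt n * bump (n / N) ^ 2 : ℝ) : ℂ) =
      ((N ^ (-(1 / 2 : ℝ)) : ℝ) : ℂ) * odV ρ q N (n / N) := by
  rw [odV, ← Complex.ofReal_mul]
  congr 1
  have hn0 : (0 : ℝ) < n := by exact_mod_cast hn
  have h1 : N * (n / N : ℝ) = n := by field_simp
  rw [h1, Resonator.G, div_eq_mul_inv (ρ.G₀.eval _ * _), ← rpow_scale_eq_inv_sqrt hn0 hN]
  ring

/-- **(W-id)** `Ŵ_T(log(1+su)/2π) · ω(u/U)² · (1+su)^{−it} = T · W_{U,t}(u/U)` for `T, U > 0`.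
[cite: BondarenkoHeap2026, §6.2, TeX l.795–832] -/
theorem odW_id (w : Bump) (B : ℕ) {T U : ℝ} (hT : 0 < T) (hU : 0 < U) (s : ℤ) (t u : ℝ) :
    ((weightHat w B T (Real.log (1 + s * u) / (2 * π)) * bump (u / U) ^ 2 : ℝ) : ℂ) *
        ((1 + s * u : ℝ) : ℂ) ^ (-(t * I)) =
      (T : ℂ) * odW w B T U s t (u / U) := by
  have h1 : (s : ℝ) * U * (u / U) = s * u := by field_simp
  rw [odW, h1]
  push_cast
  rw [weightHat_eq]
  have hT' : (T : ℂ) ≠ 0 := Complex.ofReal_ne_zero.2 hT.ne'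
  field_simp

/-- **(α-id)** `g_h(k) k^{−1/2} ω(k/K)² (k/K)^{−z} = n_A K^{−1/2} · α(k)` for `k ≥ 1`, `K > 0`.
[cite: BondarenkoHeap2026, Proposition 1 p. 7 (g_h) and §6.2, TeX l.834–836] -/
theorem odAlpha_id (c T : ℝ) {k : ℕ} (hk : 1 ≤ k) {K : ℝ} (hK : 0 < K) (z : ℂ) :
    ((gWeight (gapWidth c T) k / Real.sqrt k * bump (k / K) ^ 2 : ℝ) : ℂ) *
        ((((k : ℝ) / K : ℝ)) : ℂ) ^ (-z) =
      ((nA c * K ^ (-(1 / 2 : ℝ)) : ℝ) : ℂ) * odAlpha c T K z k := by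
  rw [odAlpha, ← mul_assoc]
  congr 1
  rw [odAlphaProfile, ← Complex.ofReal_mul]
  congr 1
  have hk0 : (0 : ℝ) < k := by exact_mod_cast hk
  have h1 : K * (k / K : ℝ) = k := by field_simp
  have hnA : nA c ≠ 0 := ne_of_gt (lt_of_lt_of_le one_pos (le_max_left _ _))
  rw [h1, gWeight, div_eq_mul_inv _ (Real.sqrt k), ← rpow_scale_eq_inv_sqrt hk0 hK]
  field_simp

/-- **(β-id)** `G(m) m^{−1/2} ω(m/M)² (m/M)^{−z} = n_B M^{−1/2} · β(m)` for `m ≥ 1`, `M > 0`.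
[cite: BondarenkoHeap2026, §2.3 p. 8 (G(n)) and §6.2, TeX l.834–836] -/
theorem odBeta_id (ρ : Resonator) (q : ℕ) {m : ℕ} (hm : 1 ≤ m) {M : ℝ} (hM : 0 < M) (z : ℂ) :
    ((ρ.G q m / Real.sqrt m * bump (m / M) ^ 2 : ℝ) : ℂ) * ((((m : ℝ) / M : ℝ)) : ℂ) ^ (-z) =
      ((nB ρ * M ^ (-(1 / 2 : ℝ)) : ℝ) : ℂ) * odBeta ρ q M z m := by
  rw [odBeta, ← mul_assoc]
  congr 1
  rw [odBetaProfile, ← Complex.ofReal_mul]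
  congr 1
  have hm0 : (0 : ℝ) < m := by exact_mod_cast hm
  have h1 : M * (m / M : ℝ) = m := by field_simp
  have hnB : nB ρ ≠ 0 := ne_of_gt (lt_of_lt_of_le one_pos (le_max_left _ _))
  rw [h1, Resonator.G, div_eq_mul_inv (ρ.G₀.eval _ * _) (Real.sqrt m), ← rpow_scale_eq_inv_sqrt hm0 hM]
  field_simp

/-- `β`'s profile is `V_M / n_B`. [cite: BondarenkoHeap2026, §6.2, TeX l.834–836] -/
theorem odBetaProfile_eq (ρ : Resonator) (q : ℕ) (M : ℝ) :
    odBetaProfile ρ q M = fun y => odV ρ q M y / (nB ρ : ℂ) := by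
  funext y
  rw [odBetaProfile, odV]
  push_cast
  ring

end Identities

/-! ## (K2a) Smoothness, support, uniform derivative bounds of the profiles -/

section ProfileAnalysis

/-- `V_N` in the generic profile form `ω² · (F · y^{−1/2})`. [cite: BondarenkoHeap2026, §6.2, TeX l.785–811] -/
theorem odV_eq (ρ : Resonator) (q : ℕ) (N : ℝ) : odV ρ q N = fun y => ((bump y ^ 2 *
    ((ρ.G₀.eval (Real.log (N * y) / Real.log (lengthL q)) * ρ.f₀ (N * y / lengthL q)) *
      y ^ (-(1 / 2 : ℝ))) : ℝ) : ℂ) := by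
  funext y; rw [odV]; push_cast; ring

/-- **Support of `V_N`**: `V_N(y) ≠ 0 ⇒ 1 ≤ y ≤ 2`. [cite: BondarenkoHeap2026, §6.2, TeX l.750–753] -/
theorem odV_ne_zero_imp (ρ : Resonator) (q : ℕ) (N : ℝ) {y : ℝ} (h : odV ρ q N y ≠ 0) :
    1 ≤ y ∧ y ≤ 2 := by
  rw [odV] at h
  refine bump_sq_ne_zero_imp fun h0 => h ?_
  rw [h0]; simp

/-- **`V_N ∈ C^∞(ℝ)`** (`N > 0`). [cite: BondarenkoHeap2026, §6.2, TeX l.800 ("𝓕₀ is … smooth")] -/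
theorem contDiff_odV (ρ : Resonator) (q : ℕ) {N : ℝ} (hN : 0 < N) : ContDiff ℝ ∞ (odV ρ q N) := by
  rw [odV_eq]
  refine Complex.ofRealCLM.contDiff.comp ?_
  refine contDiff_mul_of_support (𝔸 := ℝ) bump_sq_contDiff (fun y hy => bump_sq_ne_zero_imp hy)
    fun y hy => ?_
  have hy0 : 0 < y := by linarith [hy.1]
  exact (contDiffAt_Gfactor ρ q hN hy0).mul (Real.contDiffAt_rpow_const_of_ne hy0.ne')

/-- **Uniform all-order bounds for `V_N`**: for `q ≥ 2` and `1/2 ≤ N ≤ C_N · L`, every derivative of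
`V_N` is bounded on `ℝ` by a constant depending only on `(ρ, C_N, n)` ("`𝓕₀` … with bounded
derivatives", TeX l.800–804, for our `y`-side factor). [cite: BondarenkoHeap2026, §6.2, TeX l.800–804] -/
theorem exists_family_odV (ρ : Resonator) {CN : ℝ} (hCN : 0 < CN) :
    ∃ D : ℕ → ℝ, (∀ n, 0 ≤ D n) ∧ ∀ (q : ℕ), 2 ≤ q → ∀ (N : ℝ), 2⁻¹ ≤ N → N ≤ CN * lengthL q →
      ∀ (n : ℕ) (y : ℝ), ‖iteratedDeriv n (odV ρ q N) y‖ ≤ D n := by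
  obtain ⟨c, hc0, hc⟩ := exists_family_Gfactor ρ hCN
  obtain ⟨B, hB0, hB⟩ := exists_profile_family hc0
  refine ⟨B, hB0, fun q hq N hN hNL n y => ?_⟩
  obtain ⟨hF, hFc⟩ := hc q hq N hN hNL
  obtain ⟨hsmooth, hbd⟩ := hB _ hF hFc
  rw [odV_eq, norm_iteratedDeriv_ofReal hsmooth]
  exact hbd n y

/-- `α`'s profile in the generic form. [cite: BondarenkoHeap2026, §6.2, TeX l.834–836] -/
theorem odAlphaProfile_eq (c T K : ℝ) : odAlphaProfile c T K = fun y => ((bump y ^ 2 *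
    ((Real.sin (gapWidth c T * Real.log (K * y) / 2) / Real.log (K * y) / nA c) *
      y ^ (-(1 / 2 : ℝ))) : ℝ) : ℂ) := by
  funext y; rw [odAlphaProfile]; push_cast; ring

/-- `1 ≤ n_A`. [cite: BondarenkoHeap2026, Proposition 1 p. 7 (g_h)] -/
theorem one_le_nA (c : ℝ) : 1 ≤ nA c := le_max_left _ _

/-- `1 ≤ n_B`. [cite: BondarenkoHeap2026, §2.3 p. 8 (G(n))] -/
theorem one_le_nB (ρ : Resonator) : 1 ≤ nB ρ := le_max_left _ _

/-- **Support of the `α`-profile.** [cite: BondarenkoHeap2026, §6.2, TeX l.750–753] -/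
theorem odAlphaProfile_ne_zero_imp (c T K : ℝ) {y : ℝ} (h : odAlphaProfile c T K y ≠ 0) :
    1 ≤ y ∧ y ≤ 2 := by
  rw [odAlphaProfile] at h
  refine bump_sq_ne_zero_imp fun h0 => h ?_
  rw [h0]; simp

/-- **Sup bound of the `α`-profile**: `‖profile‖ ≤ 1` for `T ≥ 2`, `K ≥ √2`.
[cite: BondarenkoHeap2026, §6.2, TeX l.834–836 ("1-bounded")] -/
theorem norm_odAlphaProfile_le_one {c : ℝ} (hc : 0 < c) {T : ℝ} (hT : 2 ≤ T) {K : ℝ}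
    (hK : Real.sqrt 2 ≤ K) (y : ℝ) : ‖odAlphaProfile c T K y‖ ≤ 1 := by
  by_cases hy : 1 ≤ y ∧ y ≤ 2
  · obtain ⟨cα, -, hcα⟩ := exists_family_sincFactor hc
    obtain ⟨-, hsup, -⟩ := hcα T hT K hK
    rw [odAlphaProfile, Complex.norm_real, Real.norm_eq_abs, abs_div, abs_mul, abs_mul,
      abs_of_nonneg (sq_nonneg _), abs_of_pos (lt_of_lt_of_le one_pos (one_le_nA c)),
      div_le_one (lt_of_lt_of_le one_pos (one_le_nA c))]
    have h1 := bump_sq_le_one y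
    have h2 := hsup y hy
    have h3 : |y ^ (-(1 / 2 : ℝ))| ≤ 1 := by
      rw [abs_of_nonneg (Real.rpow_nonneg (by linarith [hy.1]) _)]
      exact Real.rpow_le_one_of_one_le_of_nonpos hy.1 (by norm_num)
    have h4 : π * c / Real.log 2 ≤ nA c := le_max_right _ _
    calc bump y ^ 2 * |Real.sin (gapWidth c T * Real.log (K * y) / 2) / Real.log (K * y)| *
          |y ^ (-(1 / 2 : ℝ))| ≤ 1 * (π * c / Real.log 2) * 1 := by
          gcongr
      _ ≤ nA c := by linarith
  · have h0 : odAlphaProfile c T K y = 0 := by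
      by_contra h; exact hy (odAlphaProfile_ne_zero_imp c T K h)
    rw [h0, norm_zero]; exact zero_le_one

/-- **Uniform all-order bounds and smoothness of the `α`-profile** (`T ≥ 2`, `K ≥ √2`), order-`0`
constant `1`. [cite: BondarenkoHeap2026, §6.2, TeX l.834–836] -/
theorem exists_family_odAlphaProfile {c : ℝ} (hc : 0 < c) :
    ∃ B : ℕ → ℝ, (∀ n, 0 ≤ B n) ∧ B 0 ≤ 1 ∧ ∀ (T : ℝ), 2 ≤ T → ∀ (K : ℝ), Real.sqrt 2 ≤ K →
      ContDiff ℝ ∞ (odAlphaProfile c T K) ∧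
      ∀ (n : ℕ) (y : ℝ), ‖iteratedDeriv n (odAlphaProfile c T K) y‖ ≤ B n := by
  obtain ⟨cα, hcα0, hcα⟩ := exists_family_sincFactor hc
  obtain ⟨B, hB0, hB⟩ := exists_profile_family hcα0
  refine ⟨fun n => if n = 0 then 1 else B n, fun n => ?_, by simp, fun T hT K hK => ?_⟩
  · by_cases hn : n = 0
    · simp [hn]
    · simp only [hn, if_false]; exact hB0 n
  obtain ⟨hF, -, hFc⟩ := hcα T hT K hK
  have hnA0 : 0 < nA c := lt_of_lt_of_le one_pos (one_le_nA c)
  -- the divided factor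
  have hF' : ∀ y ∈ Set.Icc (1 : ℝ) 2, ContDiffAt ℝ ∞
      (fun y => Real.sin (gapWidth c T * Real.log (K * y) / 2) / Real.log (K * y) / nA c) y :=
    fun y hy => (hF y hy).div_const _
  have hFc' : ∀ (i : ℕ), ∀ y ∈ Set.Icc (1 : ℝ) 2, ‖iteratedDeriv i
      (fun y => Real.sin (gapWidth c T * Real.log (K * y) / 2) / Real.log (K * y) / nA c) y‖ ≤ cα i := by
    intro i y hy
    rw [iteratedDeriv_div_const, norm_div, Real.norm_eq_abs (nA c), abs_of_pos hnA0]
    exact (div_le_self (norm_nonneg _) (one_le_nA c)).trans (hFc i y hy)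
  obtain ⟨hsmooth, hbd⟩ := hB _ hF' hFc'
  have hsmoothC : ContDiff ℝ ∞ (odAlphaProfile c T K) := by
    rw [odAlphaProfile_eq]; exact Complex.ofRealCLM.contDiff.comp hsmooth
  refine ⟨hsmoothC, fun n y => ?_⟩
  by_cases hn : n = 0
  · subst hn
    simp only [if_true, iteratedDeriv_zero]
    exact norm_odAlphaProfile_le_one hc hT hK y
  · simp only [hn, if_false]
    rw [odAlphaProfile_eq, norm_iteratedDeriv_ofReal hsmooth]
    exact hbd n y

/-- **(K3, α) The separated `k`-weights lie in the corrected class with ONE family**: for `c > 0`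
there is `A` (depending on `c` only) with `α ∈ IsSmoothDyadicWeight' K A (1+‖z‖)` for all `T ≥ 2`,
`K ≥ √2`, `Re z ≥ 0`. [cite: BondarenkoHeap2026, §6.2, TeX l.808–811 and l.834–836] -/
theorem exists_family_odAlpha {c : ℝ} (hc : 0 < c) :
    ∃ A : ℕ → ℝ, ∀ (T : ℝ), 2 ≤ T → ∀ (K : ℝ), Real.sqrt 2 ≤ K → ∀ (z : ℂ), 0 ≤ z.re →
      IsSmoothDyadicWeight' K A (1 + ‖z‖) (odAlpha c T K z) := by
  obtain ⟨B, hB0, hB1, hB⟩ := exists_family_odAlphaProfile hc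
  refine ⟨fun n => ((n : ℝ) + 1) ^ n * ∑ i ∈ Finset.range (n + 1), (n.choose i : ℝ) * B i,
    fun T hT K hK z hz => ?_⟩
  obtain ⟨hsmooth, hbd⟩ := hB T hT K hK
  have hK0 : 0 < K := lt_of_lt_of_le (Real.sqrt_pos.2 two_pos) hK
  exact MellinSeparated.isSmoothDyadicWeight'_separatedWeight hsmooth
    (fun y hy => odAlphaProfile_ne_zero_imp c T K hy) hbd hB1 hz hK0


/-- **Support of the `β`-profile.** [cite: BondarenkoHeap2026, §6.2, TeX l.750–753] -/
theorem odBetaProfile_ne_zero_imp (ρ : Resonator) (q : ℕ) (M : ℝ) {y : ℝ}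
    (h : odBetaProfile ρ q M y ≠ 0) : 1 ≤ y ∧ y ≤ 2 := by
  rw [odBetaProfile_eq] at h
  exact odV_ne_zero_imp ρ q M fun h0 => h (by simp only [h0, zero_div])

/-- `V_M ≡ 0` once `M ≥ L` (`f₀ = 0` on `[1, ∞)`, `ω = 0` on `(−∞, 1]`).
[cite: BondarenkoHeap2026, §2.3 p. 8 (f = 0 beyond L)] -/
theorem odV_eq_zero_of_lengthL_le (ρ : Resonator) {q : ℕ} (hq : 1 ≤ q) {M : ℝ} (hM : lengthL q ≤ M) :
    odV ρ q M = 0 := by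
  funext y
  rw [odV, Pi.zero_apply]
  by_cases hy : y ≤ 1
  · rw [SmoothDyadicPartition.bump_eq_zero_of_le_one hy]; simp
  · have hL := lengthL_pos hq
    have h1 : 1 ≤ M * y / lengthL q := by
      rw [le_div_iff₀ hL]; nlinarith
    rw [ρ.f₀_eq_zero _ h1]; simp

/-- `|P(w)| ≤ Σᵢ |pᵢ| 2ⁱ` for `|w| ≤ 2`. [folklore] -/
private theorem abs_eval_le_of_abs_le_two (P : Polynomial ℝ) {w : ℝ} (hw : |w| ≤ 2) :
    |P.eval w| ≤ ∑ i ∈ Finset.range (P.natDegree + 1), |P.coeff i| * 2 ^ i := by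
  rw [Polynomial.eval_eq_sum_range]
  refine (Finset.abs_sum_le_sum_abs _ _).trans (Finset.sum_le_sum fun i _ => ?_)
  rw [abs_mul, abs_pow]
  exact mul_le_mul_of_nonneg_left (pow_le_pow_left₀ (abs_nonneg _) hw i) (abs_nonneg _)

/-- **Sup bound of the `β`-profile**: `‖profile‖ ≤ 1` for `q ≥ 2`, `M ≥ 1/2` (on the support,
either `f₀(My/L) = 0` or `My < L`, whence `|log(My)/log L| ≤ 1` and `|G₀| ≤ Σ|G₀,ᵢ|2ⁱ ≤ n_B`).
[cite: BondarenkoHeap2026, §6.2, TeX l.834–836 ("1-bounded")] -/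
theorem norm_odBetaProfile_le_one (ρ : Resonator) {q : ℕ} (hq : 2 ≤ q) {M : ℝ} (hM : 2⁻¹ ≤ M)
    (y : ℝ) : ‖odBetaProfile ρ q M y‖ ≤ 1 := by
  have hnB0 : 0 < nB ρ := lt_of_lt_of_le one_pos (one_le_nB ρ)
  by_cases hy : 1 ≤ y ∧ y ≤ 2
  · have hy0 : 0 < y := by linarith [hy.1]
    have hM0 : 0 < M := by linarith
    have hL := lengthL_pos (by omega : 1 ≤ q)
    have hlogL := one_le_log_lengthL hq
    rw [odBetaProfile, Complex.norm_real, Real.norm_eq_abs, abs_div, abs_of_pos hnB0,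
      div_le_one hnB0, abs_mul, abs_mul, abs_mul, abs_of_nonneg (sq_nonneg _)]
    have h1 := bump_sq_le_one y
    have h3 : |y ^ (-(1 / 2 : ℝ))| ≤ 1 := by
      rw [abs_of_nonneg (Real.rpow_nonneg hy0.le _)]
      exact Real.rpow_le_one_of_one_le_of_nonpos hy.1 (by norm_num)
    have h4 : |ρ.f₀ (M * y / lengthL q)| ≤ 1 := Glue.abs_f₀_le_one ρ (by positivity)
    by_cases hf : ρ.f₀ (M * y / lengthL q) = 0
    · rw [hf, abs_zero, mul_zero, zero_mul]; exact hnB0.le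
    · have hMy : M * y / lengthL q < 1 := by
        by_contra hcon
        exact hf (ρ.f₀_eq_zero _ (not_lt.1 hcon))
      have hMyL : M * y < lengthL q := by rwa [div_lt_one hL] at hMy
      have hw : |Real.log (M * y) / Real.log (lengthL q)| ≤ 2 := by
        rw [abs_div, abs_of_pos (a := Real.log (lengthL q)) (by linarith),
          div_le_iff₀ (by linarith)]
        have hup : Real.log (M * y) ≤ Real.log (lengthL q) :=
          Real.log_le_log (by positivity) hMyL.le
        have hlo : -Real.log 2 ≤ Real.log (M * y) := by
          have : Real.log 2⁻¹ ≤ Real.log (M * y) := Real.log_le_log (by norm_num) (by nlinarith)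
          rwa [Real.log_inv] at this
        have h2L := log_two_le_log_lengthL hq
        rw [abs_le]; constructor <;> linarith
      have h2 : |ρ.G₀.eval (Real.log (M * y) / Real.log (lengthL q))| ≤ nB ρ :=
        (abs_eval_le_of_abs_le_two ρ.G₀ hw).trans (le_max_right _ _)
      calc bump y ^ 2 * |ρ.G₀.eval (Real.log (M * y) / Real.log (lengthL q))| *
            |ρ.f₀ (M * y / lengthL q)| * |y ^ (-(1 / 2 : ℝ))| ≤ 1 * nB ρ * 1 * 1 := by
            gcongr
        _ = nB ρ := by ring
  · have h0 : odBetaProfile ρ q M y = 0 := by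
      by_contra h; exact hy (odBetaProfile_ne_zero_imp ρ q M h)
    rw [h0, norm_zero]; exact zero_le_one

/-- **Uniform all-order bounds and smoothness of the `β`-profile** (`q ≥ 2`, `M ≥ 1/2`; for
`M ≥ L` the profile vanishes identically), order-`0` constant `1`.
[cite: BondarenkoHeap2026, §6.2, TeX l.834–836] -/
theorem exists_family_odBetaProfile (ρ : Resonator) :
    ∃ B : ℕ → ℝ, (∀ n, 0 ≤ B n) ∧ B 0 ≤ 1 ∧ ∀ (q : ℕ), 2 ≤ q → ∀ (M : ℝ), 2⁻¹ ≤ M →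
      ContDiff ℝ ∞ (odBetaProfile ρ q M) ∧
      ∀ (n : ℕ) (y : ℝ), ‖iteratedDeriv n (odBetaProfile ρ q M) y‖ ≤ B n := by
  obtain ⟨D, hD0, hD⟩ := exists_family_odV ρ one_pos
  refine ⟨fun n => if n = 0 then 1 else D n, fun n => ?_, by simp, fun q hq M hM => ?_⟩
  · by_cases hn : n = 0
    · simp [hn]
    · simp only [hn, if_false]; exact hD0 n
  have hM0 : 0 < M := by linarith
  have hnB0 : 0 < nB ρ := lt_of_lt_of_le one_pos (one_le_nB ρ)
  have hsmooth : ContDiff ℝ ∞ (odBetaProfile ρ q M) := by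
    rw [odBetaProfile_eq]; exact (contDiff_odV ρ q hM0).div_const _
  refine ⟨hsmooth, fun n y => ?_⟩
  by_cases hn : n = 0
  · subst hn
    simp only [if_true, iteratedDeriv_zero]
    exact norm_odBetaProfile_le_one ρ hq hM y
  · simp only [hn, if_false]
    rw [odBetaProfile_eq, iteratedDeriv_div_const, norm_div, Complex.norm_real, Real.norm_eq_abs,
      abs_of_pos hnB0]
    refine (div_le_self (norm_nonneg _) (one_le_nB ρ)).trans ?_
    by_cases hML : M ≤ 1 * lengthL q
    · exact hD q hq M hM hML n y
    · rw [odV_eq_zero_of_lengthL_le ρ (by omega) (by linarith [not_le.1 hML])]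
      have h0 : iteratedDeriv n (fun _ : ℝ => (0 : ℂ)) y = 0 := by
        rw [iteratedDeriv_const]; simp [hn]
      rw [show (0 : ℝ → ℂ) = fun _ => 0 from rfl, h0, norm_zero]; exact hD0 n

/-- **(K3, β) The separated `m`-weights lie in the corrected class with ONE family**: there is
`A` (depending on `ρ` only) with `β ∈ IsSmoothDyadicWeight' M A (1+‖z‖)` for all `q ≥ 2`,
`M ≥ 1/2`, `Re z ≥ 0`. [cite: BondarenkoHeap2026, §6.2, TeX l.808–811 and l.834–836] -/
theorem exists_family_odBeta (ρ : Resonator) :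
    ∃ A : ℕ → ℝ, ∀ (q : ℕ), 2 ≤ q → ∀ (M : ℝ), 2⁻¹ ≤ M → ∀ (z : ℂ), 0 ≤ z.re →
      IsSmoothDyadicWeight' M A (1 + ‖z‖) (odBeta ρ q M z) := by
  obtain ⟨B, hB0, hB1, hB⟩ := exists_family_odBetaProfile ρ
  refine ⟨fun n => ((n : ℝ) + 1) ^ n * ∑ i ∈ Finset.range (n + 1), (n.choose i : ℝ) * B i,
    fun q hq M hM z hz => ?_⟩
  obtain ⟨hsmooth, hbd⟩ := hB q hq M hM
  have hM0 : 0 < M := by linarith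
  exact MellinSeparated.isSmoothDyadicWeight'_separatedWeight hsmooth
    (fun y hy => odBetaProfile_ne_zero_imp ρ q M hy) hbd hB1 hz hM0

end ProfileAnalysis

/-! ## (K2a, W) Smoothness, support and uniform derivative bounds of the `u`-side kernel -/

section WAnalysis

/-- `y ↦ y^w` (real `y`, complex `w`) is smooth at every `y > 0` (copy of the private lemma of
`MellinSeparatedWeights`). [cite: BondarenkoHeap2026, §6.2, TeX l.808–811] -/
theorem contDiffAt_ofReal_cpow_const {y : ℝ} (hy : 0 < y) (w : ℂ) {n : WithTop ℕ∞} :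
    ContDiffAt ℝ n (fun y : ℝ => ((y : ℝ) : ℂ) ^ w) y := by
  have hev : (fun y : ℝ => ((y : ℝ) : ℂ) ^ w) =ᶠ[𝓝 y]
      fun y : ℝ => Complex.exp (w * (Real.log y : ℂ)) := by
    filter_upwards [Ioi_mem_nhds hy] with z hz
    rw [Complex.cpow_def_of_ne_zero (by exact_mod_cast hz.ne'), ← Complex.ofReal_log hz.le, mul_comm]
  refine ContDiffAt.congr_of_eventuallyEq ?_ hev
  have hlog : ContDiffAt ℝ n Real.log y := Real.contDiffAt_log.2 hy.ne'
  have h2 : ContDiffAt ℝ n (fun z : ℝ => ((Real.log z : ℝ) : ℂ)) y :=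
    Complex.ofRealCLM.contDiff.comp_contDiffAt y hlog
  exact Complex.contDiff_exp.comp_contDiffAt y (contDiffAt_const.mul h2)

/-- `‖∏_{l<n} (−s − l)‖ ≤ (‖s‖ + n)ⁿ`. [cite: BondarenkoHeap2026, §6.2, TeX l.808–811] -/
theorem norm_prod_neg_sub_le (s : ℂ) (n : ℕ) :
    ‖∏ l ∈ Finset.range n, (-s - (l : ℂ))‖ ≤ (‖s‖ + n) ^ n := by
  rw [norm_prod]
  calc ∏ l ∈ Finset.range n, ‖-s - (l : ℂ)‖ ≤ ∏ _l ∈ Finset.range n, (‖s‖ + n) := by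
        refine Finset.prod_le_prod (fun l _ => norm_nonneg _) fun l hl => ?_
        rw [Finset.mem_range] at hl
        calc ‖-s - (l : ℂ)‖ ≤ ‖-s‖ + ‖(l : ℂ)‖ := norm_sub_le _ _
          _ = ‖s‖ + l := by rw [norm_neg, Complex.norm_natCast]
          _ ≤ ‖s‖ + n := by
              have : (l : ℝ) ≤ n := by exact_mod_cast hl.le
              linarith
    _ = (‖s‖ + n) ^ n := by rw [Finset.prod_const, Finset.card_range]

/-- **The power factor `v ↦ (1 + a v)^{−it}`**: for `|a| ≤ 1/4`, `|a|·|t| ≤ C`, `v ∈ [1,2]`: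
`‖∂ᵛⁿ (1+av)^{−it}‖ ≤ (2(C + n))ⁿ` ("differentiating … gives a factor of `−s₁` which is then
`≪ q^ε`", TeX l.810, in the `u`-variable: each derivative costs `U·(|t| + n)`).
[cite: BondarenkoHeap2026, §6.2, TeX l.808–811] -/
theorem norm_iteratedDeriv_affine_cpow_le {a t C : ℝ} (ha : |a| ≤ 1 / 4) (hat : |a| * |t| ≤ C)
    (n : ℕ) {v : ℝ} (hv : v ∈ Set.Icc (1 : ℝ) 2) :
    ‖iteratedDeriv n (fun v : ℝ => ((1 + a * v : ℝ) : ℂ) ^ (-(t * I))) v‖ ≤ (2 * (C + n)) ^ n := by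
  have hav : 1 / 2 ≤ 1 + a * v := by
    have : |a * v| ≤ 1 / 4 * 2 := by
      rw [abs_mul]; exact mul_le_mul ha (by rw [abs_of_pos (by linarith [hv.1])]; exact hv.2)
        (abs_nonneg _) (by norm_num)
    have := neg_abs_le (a * v); linarith
  have hy0 : 0 < 1 + a * v := by linarith
  have heq : (fun v : ℝ => ((1 + a * v : ℝ) : ℂ) ^ (-(t * I))) =
      fun v : ℝ => (fun y : ℝ => ((y : ℝ) : ℂ) ^ (-(t * I))) (1 + a * v) := by
    funext v; push_cast; ring_nf
  rw [heq, iteratedDeriv_comp_const_add_mul (fun y : ℝ => ((y : ℝ) : ℂ) ^ (-(t * I))) 1 a n v,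
    MellinSeparated.iteratedDeriv_cpow_neg (t * I) n hy0, norm_smul, norm_pow, Real.norm_eq_abs,
    norm_mul, Complex.norm_cpow_eq_rpow_re_of_pos hy0]
  have hre : (-(t * I) - (n : ℂ)).re = -(n : ℝ) := by simp
  rw [hre]
  have h1 : ‖∏ l ∈ Finset.range n, (-(t * I) - (l : ℂ))‖ ≤ (|t| + n) ^ n := by
    have := norm_prod_neg_sub_le (t * I) n
    simpa [Complex.norm_mul, Complex.norm_I] using this
  have h2 : (1 + a * v) ^ (-(n : ℝ)) ≤ (2 : ℝ) ^ n := by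
    rw [Real.rpow_neg hy0.le, Real.rpow_natCast, ← inv_pow]
    exact pow_le_pow_left₀ (by positivity) (by rw [inv_le_comm₀ hy0 two_pos]; linarith) n
  have ha0 : 0 ≤ |a| := abs_nonneg _
  calc |a| ^ n * (‖∏ l ∈ Finset.range n, (-(t * I) - (l : ℂ))‖ * (1 + a * v) ^ (-(n : ℝ)))
      ≤ |a| ^ n * ((|t| + n) ^ n * (2 : ℝ) ^ n) := by
        gcongr
    _ = (2 * (|a| * |t| + |a| * n)) ^ n := by rw [← mul_pow, ← mul_pow]; ring
    _ ≤ (2 * (C + n)) ^ n := by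
        apply pow_le_pow_left₀ (by positivity)
        have : |a| * n ≤ 1 * n := mul_le_mul_of_nonneg_right (by linarith) (Nat.cast_nonneg _)
        linarith

/-- The power factor is smooth at `v` when `1 + a v > 0`. [cite: BondarenkoHeap2026, §6.2, TeX l.808–811] -/
theorem contDiffAt_affine_cpow {a v : ℝ} (hav : 0 < 1 + a * v) (z : ℂ) :
    ContDiffAt ℝ ∞ (fun v : ℝ => ((1 + a * v : ℝ) : ℂ) ^ z) v := by
  have heq : (fun v : ℝ => ((1 + a * v : ℝ) : ℂ) ^ z) =
      (fun y : ℝ => ((y : ℝ) : ℂ) ^ z) ∘ fun v : ℝ => 1 + a * v := by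
    funext v; simp
  rw [heq]
  exact (contDiffAt_ofReal_cpow_const hav z).comp v (by fun_prop)

/-- `W_{U,t}` in the generic product form `ω² · (F₁ · F₂)`. [cite: BondarenkoHeap2026, §6.2, TeX l.795–832] -/
theorem odW_eq (w : Bump) (B : ℕ) (T U : ℝ) (s : ℤ) (t : ℝ) :
    odW w B T U s t = fun v => ((bump v ^ 2 : ℝ) : ℂ) *
      ((𝓕 (fun τ : ℝ => (weight w B T τ : ℂ)) (Real.log (1 + (s * U) * v) / (2 * π)) / (T : ℂ)) *
        ((1 + (s * U) * v : ℝ) : ℂ) ^ (-(t * I))) := by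
  funext v; simp only [odW, mul_assoc]

/-- **Support of `W_{U,t}`.** [cite: BondarenkoHeap2026, §6.2, TeX l.750–753] -/
theorem odW_ne_zero_imp (w : Bump) (B : ℕ) (T U : ℝ) (s : ℤ) (t : ℝ) {v : ℝ}
    (h : odW w B T U s t v ≠ 0) : 1 ≤ v ∧ v ≤ 2 := by
  rw [odW_eq] at h
  have h' : ((bump v ^ 2 : ℝ) : ℂ) ≠ 0 := left_ne_zero_of_mul h
  exact bump_sq_ne_zero_imp (by exact_mod_cast h')

/-- For `s = ±1` and `0 < U ≤ 1/4`: `|sU| ≤ 1/4`. [folklore] -/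
private theorem abs_sign_mul_le {s : ℤ} (hs : s = 1 ∨ s = -1) {U : ℝ} (hU : 0 < U) (hU4 : U ≤ 1 / 4) :
    |(s : ℝ) * U| ≤ 1 / 4 ∧ |(s : ℝ) * U| = U := by
  have h : |(s : ℝ) * U| = U := by
    rcases hs with rfl | rfl <;> simp [abs_of_pos hU]
  exact ⟨by rw [h]; exact hU4, h⟩

/-- **`W_{U,t} ∈ C^∞(ℝ)`** for `T ≥ 1`, `0 < U ≤ 1/4`, `s = ±1`.
[cite: BondarenkoHeap2026, §6.2, TeX l.800 ("smooth")] -/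
theorem contDiff_odW (w : Bump) (B : ℕ) {T : ℝ} (hT : 1 ≤ T) {U : ℝ} (hU : 0 < U) (hU4 : U ≤ 1 / 4)
    {s : ℤ} (hs : s = 1 ∨ s = -1) (t : ℝ) : ContDiff ℝ ∞ (odW w B T U s t) := by
  rw [odW_eq]
  have hψ : ContDiff ℝ ∞ fun v : ℝ => ((bump v ^ 2 : ℝ) : ℂ) :=
    Complex.ofRealCLM.contDiff.comp bump_sq_contDiff
  refine contDiff_mul_of_support hψ (fun v hv => bump_sq_ne_zero_imp (by exact_mod_cast hv))
    fun v hv => ?_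
  obtain ⟨ha, -⟩ := abs_sign_mul_le hs hU hU4
  have hav : 0 < 1 + (s * U) * v := by
    have : |(s : ℝ) * U * v| ≤ 1 / 4 * 2 := by
      rw [abs_mul]; exact mul_le_mul ha (by rw [abs_of_pos (by linarith [hv.1])]; exact hv.2)
        (abs_nonneg _) (by norm_num)
    have := neg_abs_le ((s : ℝ) * U * v); linarith
  refine ContDiffAt.mul ?_ (contDiffAt_affine_cpow hav _)
  refine ContDiffAt.div_const ?_ _
  have hg := contDiff_fourier_weight w B hT
  exact hg.contDiffAt.comp v (((contDiffOn_log_affine ((s : ℝ) * U)).contDiffAt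
    ((isOpen_log_affine_dom _).mem_nhds hav)))

/-- **Uniform all-order bounds for `W_{U,t}`** ("integration by parts shows `𝓕̃₀ ≪_j ∏(1+|t_i|)^{−j}`",
TeX l.800–804, for our `u`-side factor): for `T ≥ 1`, `0 < U ≤ 1/4`, `U·T ≤ C_U`, `s = ±1`,
`U·|t| ≤ C_U`, every derivative of `W_{U,t}` is bounded on `ℝ` by a constant depending only on
`(w, B, C_U, n)` — each `∂_v` of `Ŵ_T(log(1+sUv)/2π)` costs `U·T` (by `|Ŵ_T^{(n)}| ≤ C_n T^{n+1}`)
and each `∂_v` of `(1+sUv)^{−it}` costs `U(|t|+n)`. [cite: BondarenkoHeap2026, §6.2, TeX l.800–811] -/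
theorem exists_family_odW (w : Bump) (B : ℕ) {CU : ℝ} (hCU : 0 < CU) :
    ∃ Mf : ℕ → ℝ, (∀ n, 0 ≤ Mf n) ∧ ∀ (T : ℝ), 1 ≤ T → ∀ (U : ℝ), 0 < U → U ≤ 1 / 4 → U * T ≤ CU →
      ∀ (s : ℤ), (s = 1 ∨ s = -1) → ∀ (t : ℝ), U * |t| ≤ CU →
      ∀ (n : ℕ) (v : ℝ), ‖iteratedDeriv n (odW w B T U s t) v‖ ≤ Mf n := by
  -- constants of the Fourier weight: `‖(𝓕W_T)^{(i)}‖ ≤ CW i · T^{i+1}`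
  set CW : ℕ → ℝ := fun i => (2 * π) ^ i * ∫ u : ℝ, |u| ^ i * weight w B 1 u with hCW
  have hCW0 : ∀ i, 0 ≤ CW i := fun i => mul_nonneg (by positivity)
    (integral_nonneg fun u => mul_nonneg (by positivity) (weight_nonneg w B 1 u))
  set CW' : ℕ → ℝ := fun n => ∑ i ∈ Finset.range (n + 1), CW i with hCW'
  have hCW'ge : ∀ {i n : ℕ}, i ≤ n → CW i ≤ CW' n := fun {i n} hin =>
    Finset.single_le_sum (f := CW) (fun j _ => hCW0 j) (Finset.mem_range.2 (by omega))
  have hCW'0 : ∀ n, 0 ≤ CW' n := fun n => Finset.sum_nonneg fun i _ => hCW0 i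
  -- the two factor families
  set c1 : ℕ → ℝ := fun n => (Nat.factorial n) * CW' n * (2 * max 1 (n : ℝ) * CU) ^ n with hc1
  have hc10 : ∀ n, 0 ≤ c1 n := fun n =>
    mul_nonneg (mul_nonneg (Nat.cast_nonneg _) (hCW'0 n)) (pow_nonneg (by positivity) _)
  set c2 : ℕ → ℝ := fun n => (2 * (CU + n)) ^ n with hc2
  have hc20 : ∀ n, 0 ≤ c2 n := fun n => by positivity
  set c : ℕ → ℝ := fun n => ∑ i ∈ Finset.range (n + 1), (n.choose i : ℝ) * c1 i * c2 (n - i) with hc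
  have hc0 : ∀ n, 0 ≤ c n := fun n =>
    Finset.sum_nonneg fun i _ => mul_nonneg (mul_nonneg (Nat.cast_nonneg _) (hc10 i)) (hc20 _)
  -- bump² family (complex)
  obtain ⟨b, hb0, -, hb⟩ := exists_family_bump_sq
  refine ⟨fun n => ∑ i ∈ Finset.range (n + 1), (n.choose i : ℝ) * b i * c (n - i), fun n =>
    Finset.sum_nonneg fun i _ => mul_nonneg (mul_nonneg (Nat.cast_nonneg _) (hb0 i)) (hc0 _), ?_⟩
  intro T hT U hU hU4 hUT s hs t hUt n v
  obtain ⟨ha, haU⟩ := abs_sign_mul_le hs hU hU4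
  set a : ℝ := (s : ℝ) * U with haa
  have hT0 : 0 < T := by linarith
  set g : ℝ → ℂ := 𝓕 (fun τ : ℝ => (weight w B T τ : ℂ)) with hg
  have hgs : ContDiff ℝ ∞ g := contDiff_fourier_weight w B hT
  set f : ℝ → ℝ := fun v => Real.log (1 + a * v) / (2 * π) with hf
  -- positivity of `1 + a v` on `[1,2]`
  have hpos : ∀ v ∈ Set.Icc (1 : ℝ) 2, 1 / 2 ≤ 1 + a * v := by
    intro v hv
    have : |a * v| ≤ 1 / 4 * 2 := by
      rw [abs_mul]; exact mul_le_mul ha (by rw [abs_of_pos (by linarith [hv.1])]; exact hv.2)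
        (abs_nonneg _) (by norm_num)
    have := neg_abs_le (a * v); linarith
  -- factor 1: `(g ∘ f)/T`
  have hF1 : ∀ v ∈ Set.Icc (1 : ℝ) 2, ContDiffAt ℝ ∞ (fun v => g (f v) / (T : ℂ)) v := by
    intro v hv
    refine ContDiffAt.div_const ?_ _
    exact hgs.contDiffAt.comp v (((contDiffOn_log_affine a).contDiffAt
      ((isOpen_log_affine_dom _).mem_nhds (by exact lt_of_lt_of_le (by norm_num) (hpos v hv)))))
  have hF1c : ∀ (i : ℕ), ∀ v ∈ Set.Icc (1 : ℝ) 2, ‖iteratedDeriv i (fun v => g (f v) / (T : ℂ)) v‖ ≤ c1 i := by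
    intro i v hv
    rw [iteratedDeriv_div_const, norm_div, Complex.norm_real, Real.norm_eq_abs, abs_of_pos hT0,
      div_le_iff₀ hT0]
    have hcomp : ‖iteratedDeriv i (g ∘ f) v‖ ≤
        (Nat.factorial i) * (CW' i * T ^ (i + 1)) * (2 * |a| * max 1 (i : ℝ)) ^ i := by
      refine norm_iteratedDeriv_comp_le (isOpen_log_affine_dom a) hgs (contDiffOn_log_affine a)
        (by exact lt_of_lt_of_le (by norm_num) (hpos v hv)) ?_ ?_
      · intro j hj
        calc ‖iteratedDeriv j g (f v)‖ ≤ (2 * π) ^ j * T ^ (j + 1) * ∫ u : ℝ, |u| ^ j * weight w B 1 u :=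
              norm_iteratedDeriv_fourier_weight_le w B hT j (f v)
          _ = CW j * T ^ (j + 1) := by simp only [hCW]; ring
          _ ≤ CW' i * T ^ (i + 1) :=
              mul_le_mul (hCW'ge hj) (pow_le_pow_right₀ hT (by omega)) (by positivity) (hCW'0 i)
      · intro j hj1 hj
        refine (norm_iteratedDeriv_log_affine_le (hpos v hv) hj1).trans ?_
        apply pow_le_pow_left₀ (by positivity)
        have : (j : ℝ) ≤ max 1 (i : ℝ) := (show (j : ℝ) ≤ i by exact_mod_cast hj).trans (le_max_right _ _)
        nlinarith [abs_nonneg a]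
    have hcomp' : (fun v => g (f v)) = g ∘ f := rfl
    rw [hcomp']
    refine hcomp.trans ?_
    -- `i! CW' T^{i+1} (2|a| m)^i = i! CW' (2 m)^i (|a| T)^i T ≤ c1 i * T`
    have haT : |a| * T ≤ CU := by rw [haU]; exact hUT
    have hm0 : 0 ≤ 2 * max 1 (i : ℝ) := by positivity
    calc (Nat.factorial i : ℝ) * (CW' i * T ^ (i + 1)) * (2 * |a| * max 1 (i : ℝ)) ^ i
        = (Nat.factorial i) * CW' i * ((2 * max 1 (i : ℝ)) * (|a| * T)) ^ i * T := by
          rw [mul_pow, mul_pow, pow_succ]; ring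
      _ ≤ (Nat.factorial i) * CW' i * ((2 * max 1 (i : ℝ)) * CU) ^ i * T := by
          apply mul_le_mul_of_nonneg_right _ hT0.le
          apply mul_le_mul_of_nonneg_left _ (mul_nonneg (Nat.cast_nonneg _) (hCW'0 i))
          exact pow_le_pow_left₀ (by positivity) (mul_le_mul_of_nonneg_left haT hm0) i
      _ = c1 i * T := by simp only [hc1]
  -- factor 2: the power
  have hF2 : ∀ v ∈ Set.Icc (1 : ℝ) 2, ContDiffAt ℝ ∞ (fun v : ℝ => ((1 + a * v : ℝ) : ℂ) ^ (-(t * I))) v :=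
    fun v hv => contDiffAt_affine_cpow (by linarith [hpos v hv]) _
  have hF2c : ∀ (i : ℕ), ∀ v ∈ Set.Icc (1 : ℝ) 2,
      ‖iteratedDeriv i (fun v : ℝ => ((1 + a * v : ℝ) : ℂ) ^ (-(t * I))) v‖ ≤ c2 i := by
    intro i v hv
    have hat : |a| * |t| ≤ CU := by rw [haU]; exact hUt
    exact norm_iteratedDeriv_affine_cpow_le ha hat i hv
  -- the product `F = F1 * F2` on `[1,2]`
  have hF : ∀ v ∈ Set.Icc (1 : ℝ) 2, ContDiffAt ℝ ∞
      (fun v => (g (f v) / (T : ℂ)) * ((1 + a * v : ℝ) : ℂ) ^ (-(t * I))) v :=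
    fun v hv => (hF1 v hv).mul (hF2 v hv)
  have hFc : ∀ (i : ℕ), i ≤ n → ∀ v ∈ Set.Icc (1 : ℝ) 2,
      ‖iteratedDeriv i (fun v => (g (f v) / (T : ℂ)) * ((1 + a * v : ℝ) : ℂ) ^ (-(t * I))) v‖ ≤ c i := by
    intro i _ v hv
    exact norm_iteratedDeriv_mul_le ((hF1 v hv).of_le (by exact_mod_cast le_top))
      ((hF2 v hv).of_le (by exact_mod_cast le_top)) (fun j _ => hF1c j v hv) (fun j _ => hF2c j v hv)
  -- assemble with the cut-off `bump²`
  have hψ : ContDiff ℝ ∞ fun v : ℝ => ((bump v ^ 2 : ℝ) : ℂ) :=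
    Complex.ofRealCLM.contDiff.comp bump_sq_contDiff
  have hψb : ∀ (i : ℕ) (y : ℝ), ‖iteratedDeriv i (fun v : ℝ => ((bump v ^ 2 : ℝ) : ℂ)) y‖ ≤ b i := by
    intro i y; rw [norm_iteratedDeriv_ofReal bump_sq_contDiff]; exact hb i y
  rw [odW_eq]
  exact norm_iteratedDeriv_mul_le_of_support hψ
    (fun v hv => bump_sq_ne_zero_imp (by exact_mod_cast hv)) hF hψb hFc hc0 v

end WAnalysis

/-! ## (K2b–d) Mellin decay on `Re s = 0`, truncated expansions, joint continuity -/

section Mellin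

open Literature.NumberTheory.LFunctions.BondarenkoHeap2026.PrimeSums
  (mellin_eq_intervalIntegral norm_mellin_le norm_mellin_le_of_iteratedDeriv)

/-- **Decay on the imaginary axis from sup bounds of the derivatives** ("integration by parts
shows `𝓕̃₀(s) ≪_j ∏(1+|t_i|)^{−j}`", TeX l.800–804, on the line `Re s = 0`): for `V` smooth,
supported in `[1,2]`, with `‖V⁽ⁿ⁾‖_∞ ≤ Mₙ`,
`‖𝓜V(it)‖ ≤ (M₀ + M_j)·4ʲ·(1+|t|)^{−j}`. [cite: BondarenkoHeap2026, §6.2, TeX l.800–804] -/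
theorem mellin_decay_of_iteratedDeriv_bounds {V : ℝ → ℂ} (hV : ContDiff ℝ ∞ V)
    (hsupp : ∀ x, V x ≠ 0 → 1 ≤ x ∧ x ≤ 2) {M : ℕ → ℝ} (hM : ∀ (n : ℕ) (x : ℝ), ‖iteratedDeriv n V x‖ ≤ M n)
    (j : ℕ) (t : ℝ) :
    ‖mellin V (t * I)‖ ≤ (M 0 + M j) * 4 ^ j * (1 + |t|) ^ (-(j : ℝ)) := by
  have hM0 : ∀ n, 0 ≤ M n := fun n => (norm_nonneg _).trans (hM n 0)
  have hre : ((t : ℂ) * I).re = 0 := by simp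
  have h1t : 0 < 1 + |t| := by positivity
  -- the crude bound `‖𝓜V(it)‖ ≤ M 0`
  have hcrude : ‖mellin V (t * I)‖ ≤ M 0 := by
    have h := norm_mellin_le hV.continuous hsupp (M := M 0) (fun x => by simpa using hM 0 x) (t * I)
    rw [hre] at h
    have hmax : max ((0 : ℝ) - 1) 0 = 0 := by norm_num
    rw [hmax, Real.rpow_zero, mul_one] at h
    exact h
  by_cases ht : |t| ≤ 1
  · -- `(1+|t|)^{-j} ≥ 2^{-j}`
    have hlow : (2 : ℝ) ^ (-(j : ℝ)) ≤ (1 + |t|) ^ (-(j : ℝ)) := by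
      rw [Real.rpow_neg (by norm_num), Real.rpow_neg h1t.le, Real.rpow_natCast, Real.rpow_natCast]
      apply inv_anti₀ (pow_pos h1t j)
      exact pow_le_pow_left₀ h1t.le (by linarith) j
    calc ‖mellin V (t * I)‖ ≤ M 0 := hcrude
      _ ≤ (M 0 + M j) * 4 ^ j * (2 : ℝ) ^ (-(j : ℝ)) := by
          rw [Real.rpow_neg (by norm_num), Real.rpow_natCast,
            show (4 : ℝ) ^ j = 2 ^ j * 2 ^ j by rw [← mul_pow]; norm_num, mul_assoc, mul_assoc,
            mul_inv_cancel₀ (pow_ne_zero j two_ne_zero), mul_one]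
          have : (1 : ℝ) ≤ 2 ^ j := one_le_pow₀ (by norm_num)
          nlinarith [hM0 0, hM0 j]
      _ ≤ (M 0 + M j) * 4 ^ j * (1 + |t|) ^ (-(j : ℝ)) :=
          mul_le_mul_of_nonneg_left hlow
            (mul_nonneg (add_nonneg (hM0 0) (hM0 j)) (pow_nonneg (by norm_num) _))
  · -- `|t| > 1`: `j` integrations by parts
    have ht1 : 1 < |t| := not_le.1 ht
    have ht0 : t ≠ 0 := by intro h; rw [h, abs_zero] at ht1; linarith
    have hw : ∀ i : ℕ, i < j → (t : ℂ) * I + i ≠ 0 := by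
      intro i _ h
      have := congrArg Complex.im h
      simp at this
      exact ht0 this
    have h := norm_mellin_le_of_iteratedDeriv hV hsupp j (hM j) hw
    rw [hre] at h
    -- `2^{max(j-1,0)} ≤ 2^j`
    have hpow2 : (2 : ℝ) ^ max ((0 : ℝ) + j - 1) 0 ≤ 2 ^ j := by
      rw [← Real.rpow_natCast]
      exact Real.rpow_le_rpow_of_exponent_le (by norm_num) (max_le (by linarith) (Nat.cast_nonneg j))
    -- `∏ ‖it + i‖ ≥ |t|^j`
    have hprod : |t| ^ j ≤ ∏ i ∈ Finset.range j, ‖(t : ℂ) * I + (i : ℂ)‖ := by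
      calc |t| ^ j = ∏ _i ∈ Finset.range j, |t| := by rw [Finset.prod_const, Finset.card_range]
        _ ≤ ∏ i ∈ Finset.range j, ‖(t : ℂ) * I + (i : ℂ)‖ := by
            refine Finset.prod_le_prod (fun _ _ => abs_nonneg _) fun i _ => ?_
            have him : ((t : ℂ) * I + (i : ℂ)).im = t := by simp
            calc |t| = |((t : ℂ) * I + (i : ℂ)).im| := by rw [him]
              _ ≤ ‖(t : ℂ) * I + (i : ℂ)‖ := Complex.abs_im_le_norm _
    have htj : 0 < |t| ^ j := pow_pos (by linarith) j
    have hprod0 : 0 < ∏ i ∈ Finset.range j, ‖(t : ℂ) * I + (i : ℂ)‖ := lt_of_lt_of_le htj hprod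
    have h2 : ‖mellin V (t * I)‖ ≤ M j * 2 ^ j / |t| ^ j := by
      calc ‖mellin V (t * I)‖ ≤ M j * (2 : ℝ) ^ max ((0 : ℝ) + j - 1) 0 /
            ∏ i ∈ Finset.range j, ‖(t : ℂ) * I + (i : ℂ)‖ := h
        _ ≤ M j * 2 ^ j / |t| ^ j :=
            (div_le_div_of_nonneg_right (mul_le_mul_of_nonneg_left hpow2 (hM0 j)) hprod0.le).trans
              (div_le_div_of_nonneg_left (mul_nonneg (hM0 j) (pow_nonneg (by norm_num) _)) htj hprod)
    -- `|t|^{-j} ≤ 2^j (1+|t|)^{-j}` since `1 + |t| ≤ 2|t|`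
    have h3 : (|t| ^ j)⁻¹ ≤ 2 ^ j * (1 + |t|) ^ (-(j : ℝ)) := by
      have h12 : 1 + |t| ≤ 2 * |t| := by linarith
      have hpowle : (1 + |t|) ^ j ≤ (2 * |t|) ^ j := pow_le_pow_left₀ h1t.le h12 j
      rw [Real.rpow_neg h1t.le, Real.rpow_natCast]
      have h2j : (2 : ℝ) ^ j ≠ 0 := pow_ne_zero j two_ne_zero
      calc (|t| ^ j)⁻¹ = 2 ^ j * ((2 * |t|) ^ j)⁻¹ := by
            rw [mul_pow, mul_inv, ← mul_assoc, mul_inv_cancel₀ h2j, one_mul]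
        _ ≤ 2 ^ j * ((1 + |t|) ^ j)⁻¹ :=
            mul_le_mul_of_nonneg_left (inv_anti₀ (pow_pos h1t j) hpowle) (by positivity)
    calc ‖mellin V (t * I)‖ ≤ M j * 2 ^ j / |t| ^ j := h2
      _ = M j * 2 ^ j * (|t| ^ j)⁻¹ := by ring
      _ ≤ M j * 2 ^ j * (2 ^ j * (1 + |t|) ^ (-(j : ℝ))) :=
          mul_le_mul_of_nonneg_left h3 (mul_nonneg (hM0 j) (pow_nonneg (by norm_num) _))
      _ = M j * 4 ^ j * (1 + |t|) ^ (-(j : ℝ)) := by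
          rw [show (4 : ℝ) ^ j = 2 ^ j * 2 ^ j by rw [← mul_pow]; norm_num]; ring
      _ ≤ (M 0 + M j) * 4 ^ j * (1 + |t|) ^ (-(j : ℝ)) := by
          gcongr; linarith [hM0 0]

/-- **Truncated Mellin inversion on `Re s = 0`** from the same sup bounds: for `j ≥ 2`, `H ≥ 1`,
`y > 0`, `‖V(y) − (1/2π)∫_{−H}^{H} 𝓜V(it) y^{−it} dt‖ ≤ 2(M₀+M_j)4ʲ/H^{j−1}` (t4's
`mellin_truncated_inversion` at `c = 0`). [cite: BondarenkoHeap2026, §6.2, TeX l.806–808] -/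
theorem truncated_of_iteratedDeriv_bounds {V : ℝ → ℂ} (hV : ContDiff ℝ ∞ V)
    (hsupp : ∀ x, V x ≠ 0 → 1 ≤ x ∧ x ≤ 2) {M : ℕ → ℝ} (hM : ∀ (n : ℕ) (x : ℝ), ‖iteratedDeriv n V x‖ ≤ M n)
    {j : ℕ} (hj : 2 ≤ j) {H : ℝ} (hH : 1 ≤ H) {y : ℝ} (hy : 0 < y) :
    ‖V y - (1 / (2 * π)) • ∫ t in -H..H, mellin V (t * I) * (y : ℂ) ^ (-(t * I))‖ ≤
      2 * ((M 0 + M j) * 4 ^ j) / H ^ (j - 1) := by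
  have hD : ∀ t : ℝ, ‖mellin V ((0 : ℝ) + t * I)‖ ≤ (M 0 + M j) * 4 ^ j * (1 + |t|) ^ (-(j : ℝ)) := by
    intro t; simpa using mellin_decay_of_iteratedDeriv_bounds hV hsupp hM j t
  have h := MellinSeparated.mellin_truncated_inversion hV hsupp hj hD hH hy
  simp only [Complex.ofReal_zero, zero_add, neg_zero, Real.rpow_zero, one_mul] at h
  refine h.trans ?_
  have hM0 : ∀ n, 0 ≤ M n := fun n => (norm_nonneg _).trans (hM n 0)
  have hj1 : (1 : ℝ) ≤ (j : ℝ) - 1 := by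
    have : (2 : ℝ) ≤ j := by exact_mod_cast hj
    linarith
  have hHj : 0 < H ^ (j - 1) := pow_pos (by linarith) _
  rw [div_le_div_iff₀ (mul_pos (by linarith) hHj) hHj]
  have hnum : 0 ≤ 2 * ((M 0 + M j) * 4 ^ j) :=
    mul_nonneg zero_le_two (mul_nonneg (add_nonneg (hM0 0) (hM0 j)) (pow_nonneg (by norm_num) _))
  nlinarith [mul_nonneg hnum hHj.le]

/-- **(K2b) Decay of `𝓜V_N` on the imaginary axis, uniformly in `q ≥ 2`, `1/2 ≤ N ≤ C_N L`.**
[cite: BondarenkoHeap2026, §6.2, TeX l.800–804] -/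
theorem odV_mellin_decay (ρ : Resonator) :
    ∀ (CN : ℝ), 0 < CN → ∀ (j : ℕ), 2 ≤ j → ∃ D : ℝ, 0 ≤ D ∧ ∀ (q : ℕ), 2 ≤ q →
      ∀ (N : ℝ), 2⁻¹ ≤ N → N ≤ CN * lengthL q →
      ∀ t : ℝ, ‖mellin (odV ρ q N) (t * I)‖ ≤ D * (1 + |t|) ^ (-(j : ℝ)) := by
  intro CN hCN j _hj
  obtain ⟨M, hM0, hM⟩ := exists_family_odV ρ hCN
  refine ⟨(M 0 + M j) * 4 ^ j, mul_nonneg (add_nonneg (hM0 0) (hM0 j)) (pow_nonneg (by norm_num) _),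
    fun q hq N hN hNL t => ?_⟩
  have hN0 : 0 < N := by linarith
  exact mellin_decay_of_iteratedDeriv_bounds (contDiff_odV ρ q hN0) (fun y hy => odV_ne_zero_imp ρ q N hy)
    (hM q hq N hN hNL) j t

/-- **(K2b′) Truncated expansion of `V_N`** with a uniform constant.
[cite: BondarenkoHeap2026, §6.2, TeX l.806–808] -/
theorem odV_truncated (ρ : Resonator) :
    ∀ (CN : ℝ), 0 < CN → ∀ (j : ℕ), 2 ≤ j → ∃ D : ℝ, 0 ≤ D ∧ ∀ (q : ℕ), 2 ≤ q →
      ∀ (N : ℝ), 2⁻¹ ≤ N → N ≤ CN * lengthL q → ∀ (H : ℝ), 1 ≤ H → ∀ (y : ℝ), 0 < y →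
      ‖odV ρ q N y - (1 / (2 * π)) • ∫ t in -H..H, mellin (odV ρ q N) (t * I) * (y : ℂ) ^ (-(t * I))‖
        ≤ D / H ^ (j - 1) := by
  intro CN hCN j hj
  obtain ⟨M, hM0, hM⟩ := exists_family_odV ρ hCN
  refine ⟨2 * ((M 0 + M j) * 4 ^ j), mul_nonneg zero_le_two
    (mul_nonneg (add_nonneg (hM0 0) (hM0 j)) (pow_nonneg (by norm_num) _)),
    fun q hq N hN hNL H hH y hy => ?_⟩
  have hN0 : 0 < N := by linarith
  exact truncated_of_iteratedDeriv_bounds (contDiff_odV ρ q hN0) (fun y hy => odV_ne_zero_imp ρ q N hy)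
    (hM q hq N hN hNL) hj hH hy

/-- **(K2c) Decay of `𝓜W_{U,t}` on the imaginary axis, uniformly in the outer `t`.**
[cite: BondarenkoHeap2026, §6.2, TeX l.800–804] -/
theorem odW_mellin_decay (w : Bump) (B : ℕ) :
    ∀ (CU : ℝ), 0 < CU → ∀ (j : ℕ), 2 ≤ j → ∃ D : ℝ, 0 ≤ D ∧ ∀ (T : ℝ), 1 ≤ T →
      ∀ (U : ℝ), 0 < U → U ≤ 1 / 4 → U * T ≤ CU → ∀ (s : ℤ), (s = 1 ∨ s = -1) →
      ∀ (t : ℝ), U * |t| ≤ CU →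
      ∀ t' : ℝ, ‖mellin (odW w B T U s t) (t' * I)‖ ≤ D * (1 + |t'|) ^ (-(j : ℝ)) := by
  intro CU hCU j _hj
  obtain ⟨M, hM0, hM⟩ := exists_family_odW w B hCU
  refine ⟨(M 0 + M j) * 4 ^ j, mul_nonneg (add_nonneg (hM0 0) (hM0 j)) (pow_nonneg (by norm_num) _),
    fun T hT U hU hU4 hUT s hs t hUt t' => ?_⟩
  exact mellin_decay_of_iteratedDeriv_bounds (contDiff_odW w B hT hU hU4 hs t)
    (fun v hv => odW_ne_zero_imp w B T U s t hv) (hM T hT U hU hU4 hUT s hs t hUt) j t'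

/-- **(K2c′) Truncated expansion of `W_{U,t}`**, uniformly in the outer `t`.
[cite: BondarenkoHeap2026, §6.2, TeX l.806–808] -/
theorem odW_truncated (w : Bump) (B : ℕ) :
    ∀ (CU : ℝ), 0 < CU → ∀ (j : ℕ), 2 ≤ j → ∃ D : ℝ, 0 ≤ D ∧ ∀ (T : ℝ), 1 ≤ T →
      ∀ (U : ℝ), 0 < U → U ≤ 1 / 4 → U * T ≤ CU → ∀ (s : ℤ), (s = 1 ∨ s = -1) →
      ∀ (t : ℝ), U * |t| ≤ CU → ∀ (H : ℝ), 1 ≤ H → ∀ (v : ℝ), 0 < v →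
      ‖odW w B T U s t v -
          (1 / (2 * π)) • ∫ t' in -H..H, mellin (odW w B T U s t) (t' * I) * (v : ℂ) ^ (-(t' * I))‖
        ≤ D / H ^ (j - 1) := by
  intro CU hCU j hj
  obtain ⟨M, hM0, hM⟩ := exists_family_odW w B hCU
  refine ⟨2 * ((M 0 + M j) * 4 ^ j), mul_nonneg zero_le_two
    (mul_nonneg (add_nonneg (hM0 0) (hM0 j)) (pow_nonneg (by norm_num) _)),
    fun T hT U hU hU4 hUT s hs t hUt H hH v hv => ?_⟩
  exact truncated_of_iteratedDeriv_bounds (contDiff_odW w B hT hU hU4 hs t)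
    (fun v hv => odW_ne_zero_imp w B T U s t hv) (hM T hT U hU hU4 hUT s hs t hUt) hj hH hv

/-- **(K2d) Joint continuity of `(t, t') ↦ 𝓜W_{U,t}(it')`** (for the exchange of the finite
`k, m, r`-sums with the two truncated integrals). [cite: BondarenkoHeap2026, §6.2, TeX l.812 ("exchanging orders of summation and integration")] -/
theorem continuous_mellin_odW (w : Bump) (B : ℕ) {T : ℝ} (hT : 1 ≤ T) {U : ℝ} (hU : 0 < U)
    (hU4 : U ≤ 1 / 4) {s : ℤ} (hs : s = 1 ∨ s = -1) :
    Continuous fun p : ℝ × ℝ => mellin (odW w B T U s p.1) (p.2 * I) := by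
  obtain ⟨ha, -⟩ := abs_sign_mul_le hs hU hU4
  set a : ℝ := (s : ℝ) * U with haa
  -- clamp to `[1,2]`
  set cl : ℝ → ℝ := fun x => max 1 (min x 2) with hcl
  have hcl_cont : Continuous cl := by fun_prop
  have hcl1 : ∀ x, 1 ≤ cl x := fun x => le_max_left _ _
  have hcl2 : ∀ x, cl x ≤ 2 := fun x => max_le (by norm_num) (min_le_right _ _)
  have hcl_eq : ∀ x ∈ Set.Icc (1 : ℝ) 2, cl x = x := fun x hx => by
    simp only [hcl]; rw [min_eq_left hx.2, max_eq_right hx.1]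
  have hclpos : ∀ x, 1 / 2 ≤ 1 + a * cl x := by
    intro x
    have : |a * cl x| ≤ 1 / 4 * 2 := by
      rw [abs_mul]
      exact mul_le_mul ha (by rw [abs_of_pos (by linarith [hcl1 x])]; exact hcl2 x)
        (abs_nonneg _) (by norm_num)
    have := neg_abs_le (a * cl x); linarith
  -- the clamped integrand
  set Φ : ℝ × ℝ → ℝ → ℂ := fun p x => ((cl x : ℝ) : ℂ) ^ ((p.2 : ℂ) * I - 1) *
    (((bump (cl x) ^ 2 : ℝ) : ℂ) *
      (𝓕 (fun τ : ℝ => (weight w B T τ : ℂ)) (Real.log (1 + a * cl x) / (2 * π)) / (T : ℂ)) *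
      ((1 + a * cl x : ℝ) : ℂ) ^ (-((p.1 : ℂ) * I))) with hΦ
  have hΦc : Continuous (Function.uncurry Φ) := by
    have hg : Continuous (𝓕 (fun τ : ℝ => (weight w B T τ : ℂ))) := (contDiff_fourier_weight w B hT).continuous
    apply Continuous.mul
    · refine Continuous.cpow ?_ (by fun_prop) ?_
      · exact Complex.continuous_ofReal.comp (hcl_cont.comp continuous_snd)
      · intro q
        exact Complex.ofReal_mem_slitPlane.2 (by linarith [hcl1 q.2])
    · apply Continuous.mul
      · apply Continuous.mul
        · exact Complex.continuous_ofReal.comp ((bump_contDiff.continuous.comp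
            (hcl_cont.comp continuous_snd)).pow 2)
        · refine Continuous.div_const ?_ _
          refine hg.comp ?_
          refine Continuous.div_const (Continuous.log (by fun_prop) fun q => ?_) _
          linarith [hclpos q.2]
      · refine Continuous.cpow ?_ (by fun_prop) ?_
        · exact Complex.continuous_ofReal.comp (by fun_prop)
        · intro q
          exact Complex.ofReal_mem_slitPlane.2 (by linarith [hclpos q.2])
  have hint : Continuous fun p : ℝ × ℝ => ∫ x in (1 : ℝ)..2, Φ p x :=
    intervalIntegral.continuous_parametric_intervalIntegral_of_continuous' hΦc 1 2
  refine hint.congr fun p => ?_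
  rw [mellin_eq_intervalIntegral (contDiff_odW w B hT hU hU4 hs p.1).continuous
    (fun v hv => odW_ne_zero_imp w B T U s p.1 hv)]
  refine intervalIntegral.integral_congr fun x hx => ?_
  rw [Set.uIcc_of_le (by norm_num : (1 : ℝ) ≤ 2)] at hx
  simp only [hΦ, hcl_eq x hx, odW, haa]

/-- **Continuity of `W_{U,t}(v)` in the outer Mellin variable `t`** (for the exchange of the outer
truncated integral with the finite sums): for `0 < U ≤ 1/4`, `s = ±1` and any `v`,
`t ↦ W_{U,t}(v)` is continuous (on the support `1 + sUv ≥ 1/2 > 0`; off it `W ≡ 0`).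
[cite: BondarenkoHeap2026, §6.2, TeX l.812] -/
theorem continuous_odW_left (w : Bump) (B : ℕ) (T : ℝ) {U : ℝ} (hU : 0 < U) (hU4 : U ≤ 1 / 4)
    {s : ℤ} (hs : s = 1 ∨ s = -1) (v : ℝ) : Continuous fun t : ℝ => odW w B T U s t v := by
  by_cases hb : bump v = 0
  · have h0 : (fun t : ℝ => odW w B T U s t v) = fun _ => 0 := by
      funext t; simp [odW, hb]
    rw [h0]; exact continuous_const
  · obtain ⟨h1, h2⟩ := bump_ne_zero_imp hb
    have hsU : |(s : ℝ) * U| ≤ 1 / 4 := by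
      have h : |(s : ℝ) * U| = U := by rcases hs with rfl | rfl <;> simp [abs_of_pos hU]
      rw [h]; exact hU4
    have hbase : (0 : ℝ) < 1 + s * U * v := by
      have : |(s : ℝ) * U * v| ≤ 1 / 4 * 2 := by
        rw [abs_mul]; exact mul_le_mul hsU (by rw [abs_of_pos (by linarith)]; exact h2.le)
          (abs_nonneg _) (by norm_num)
      have := neg_abs_le ((s : ℝ) * U * v); linarith
    have hne : ((1 + s * U * v : ℝ) : ℂ) ≠ 0 := by exact_mod_cast hbase.ne'
    unfold odW
    refine continuous_const.mul (Continuous.const_cpow (by fun_prop) (Or.inl hne))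

end Mellin

/-! ## Guarded `u`-kernel `W′` (continuity in the outer variable for ALL parameters)

The abstract assembly (`OffDiagAssembly.admissible_box_bound`) quantifies the continuity of
`t ↦ W_{U,t}(v)` over ALL `U, s, v`.  For `odW` this holds on the admissible range
`0 < U ≤ 1/4`, `s = ±1` (`continuous_odW_left`), but not unconditionally: where the base
`1 + sUv` vanishes, `t ↦ (0 : ℂ) ^ (−it)` jumps at `t = 0`.  The guarded kernel `odW'` sets the
value to `0` at that single point; it coincides with `odW` on the admissible range (the point has
`|v| = 1/U ≥ 4`, outside the support) and satisfies the same identities and bounds. -/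

section GuardedW

/-- **Guarded `u`-kernel** `W′_{U,t}(v) = W_{U,t}(v)` if `1 + sUv ≠ 0`, else `0`; equal to `W_{U,t}`
for `0 < U ≤ 1/4`, `s = ±1` (`odW'_eq_odW`), and `t ↦ W′_{U,t}(v)` is continuous for every
`U, s, v` (`continuous_odW'_left`). [cite: BondarenkoHeap2026, §6.2, TeX l.795–832] -/
def odW' (w : Bump) (B : ℕ) (T U : ℝ) (s : ℤ) (t : ℝ) : ℝ → ℂ := fun v =>
  if 1 + (s : ℝ) * U * v = 0 then 0 else odW w B T U s t v

/-- Off the zero of the base, `W′ = W`. [cite: BondarenkoHeap2026, §6.2, TeX l.795–832] -/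
theorem odW'_apply_of_ne (w : Bump) (B : ℕ) (T U : ℝ) (s : ℤ) (t : ℝ) {v : ℝ}
    (h : 1 + (s : ℝ) * U * v ≠ 0) : odW' w B T U s t v = odW w B T U s t v := by
  simp only [odW', if_neg h]

/-- **`W′ = W` on the admissible range** `0 < U ≤ 1/4`, `s = ±1` (the base `1 + sUv ≥ 1/2` on the
support `[1,2]`; where the base vanishes both sides are `0`).
[cite: BondarenkoHeap2026, §6.2, TeX l.750–753] -/
theorem odW'_eq_odW (w : Bump) (B : ℕ) (T : ℝ) {U : ℝ} (hU : 0 < U) (hU4 : U ≤ 1 / 4) {s : ℤ}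
    (hs : s = 1 ∨ s = -1) (t : ℝ) : odW' w B T U s t = odW w B T U s t := by
  funext v
  by_cases h : 1 + (s : ℝ) * U * v = 0
  · simp only [odW', if_pos h]
    by_contra hne
    obtain ⟨h1, h2⟩ := odW_ne_zero_imp w B T U s t (Ne.symm hne)
    obtain ⟨hsU, -⟩ := abs_sign_mul_le hs hU hU4
    have hb : |(s : ℝ) * U * v| ≤ 1 / 4 * 2 := by
      rw [abs_mul]
      exact mul_le_mul hsU (by rw [abs_of_pos (by linarith)]; exact h2) (abs_nonneg _)
        (by norm_num)
    have := neg_abs_le ((s : ℝ) * U * v)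
    linarith
  · simp only [odW', if_neg h]

/-- **(W′-id)** `Ŵ_T(log(1+su)/2π) · ω(u/U)² · (1+su)^{−it} = T · W′_{U,t}(u/U)` for `T, U > 0` and
`1 + su > 0`. [cite: BondarenkoHeap2026, §6.2, TeX l.795–832] -/
theorem odW'_id (w : Bump) (B : ℕ) {T U : ℝ} (hT : 0 < T) (hU : 0 < U) (s : ℤ) (t u : ℝ)
    (hsu : 0 < 1 + (s : ℝ) * u) :
    ((weightHat w B T (Real.log (1 + s * u) / (2 * π)) * bump (u / U) ^ 2 : ℝ) : ℂ) *
        ((1 + s * u : ℝ) : ℂ) ^ (-(t * I)) =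
      (T : ℂ) * odW' w B T U s t (u / U) := by
  have h1 : 1 + (s : ℝ) * U * (u / U) ≠ 0 := by
    have : (s : ℝ) * U * (u / U) = s * u := by field_simp
    rw [this]; exact hsu.ne'
  rw [odW'_apply_of_ne w B T U s t h1]
  exact odW_id w B hT hU s t u

/-- **Support of `W′_{U,t}`.** [cite: BondarenkoHeap2026, §6.2, TeX l.750–753] -/
theorem odW'_ne_zero_imp (w : Bump) (B : ℕ) (T U : ℝ) (s : ℤ) (t : ℝ) {v : ℝ}
    (h : odW' w B T U s t v ≠ 0) : 1 ≤ v ∧ v ≤ 2 := by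
  by_cases hb : 1 + (s : ℝ) * U * v = 0
  · exact absurd (by simp only [odW', if_pos hb]) h
  · rw [odW'_apply_of_ne w B T U s t hb] at h
    exact odW_ne_zero_imp w B T U s t h

/-- **Continuity of `t ↦ W′_{U,t}(v)` for ALL `U, s, v`** (the shape quantified by the abstract
assembly). [cite: BondarenkoHeap2026, §6.2, TeX l.812] -/
theorem continuous_odW'_left (w : Bump) (B : ℕ) (T U : ℝ) (s : ℤ) (v : ℝ) :
    Continuous fun t : ℝ => odW' w B T U s t v := by
  by_cases h : 1 + (s : ℝ) * U * v = 0
  · simp only [odW', if_pos h]; exact continuous_const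
  · have hne : ((1 + s * U * v : ℝ) : ℂ) ≠ 0 := by exact_mod_cast h
    simp only [odW', if_neg h, odW]
    exact continuous_const.mul (Continuous.const_cpow (by fun_prop) (Or.inl hne))

/-- **`W′_{U,t} ∈ C^∞(ℝ)`** for `T ≥ 1`, `0 < U ≤ 1/4`, `s = ±1`.
[cite: BondarenkoHeap2026, §6.2, TeX l.800] -/
theorem contDiff_odW' (w : Bump) (B : ℕ) {T : ℝ} (hT : 1 ≤ T) {U : ℝ} (hU : 0 < U)
    (hU4 : U ≤ 1 / 4) {s : ℤ} (hs : s = 1 ∨ s = -1) (t : ℝ) : ContDiff ℝ ∞ (odW' w B T U s t) := by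
  rw [odW'_eq_odW w B T hU hU4 hs t]; exact contDiff_odW w B hT hU hU4 hs t

/-- **(K2c for `W′`)** Decay of `𝓜W′_{U,t}` on the imaginary axis, uniformly in the outer `t`.
[cite: BondarenkoHeap2026, §6.2, TeX l.800–804] -/
theorem odW'_mellin_decay (w : Bump) (B : ℕ) :
    ∀ (CU : ℝ), 0 < CU → ∀ (j : ℕ), 2 ≤ j → ∃ D : ℝ, 0 ≤ D ∧ ∀ (T : ℝ), 1 ≤ T →
      ∀ (U : ℝ), 0 < U → U ≤ 1 / 4 → U * T ≤ CU → ∀ (s : ℤ), (s = 1 ∨ s = -1) →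
      ∀ (t : ℝ), U * |t| ≤ CU →
      ∀ t' : ℝ, ‖mellin (odW' w B T U s t) (t' * I)‖ ≤ D * (1 + |t'|) ^ (-(j : ℝ)) := by
  intro CU hCU j hj
  obtain ⟨D, hD0, hD⟩ := odW_mellin_decay w B CU hCU j hj
  refine ⟨D, hD0, fun T hT U hU hU4 hUT s hs t hUt t' => ?_⟩
  rw [odW'_eq_odW w B T hU hU4 hs t]
  exact hD T hT U hU hU4 hUT s hs t hUt t'

/-- **(K2c′ for `W′`)** Truncated expansion of `W′_{U,t}`, uniformly in the outer `t`.
[cite: BondarenkoHeap2026, §6.2, TeX l.806–808] -/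
theorem odW'_truncated (w : Bump) (B : ℕ) :
    ∀ (CU : ℝ), 0 < CU → ∀ (j : ℕ), 2 ≤ j → ∃ D : ℝ, 0 ≤ D ∧ ∀ (T : ℝ), 1 ≤ T →
      ∀ (U : ℝ), 0 < U → U ≤ 1 / 4 → U * T ≤ CU → ∀ (s : ℤ), (s = 1 ∨ s = -1) →
      ∀ (t : ℝ), U * |t| ≤ CU → ∀ (H : ℝ), 1 ≤ H → ∀ (v : ℝ), 0 < v →
      ‖odW' w B T U s t v -
          (1 / (2 * π)) • ∫ t' in -H..H, mellin (odW' w B T U s t) (t' * I) * (v : ℂ) ^ (-(t' * I))‖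
        ≤ D / H ^ (j - 1) := by
  intro CU hCU j hj
  obtain ⟨D, hD0, hD⟩ := odW_truncated w B CU hCU j hj
  refine ⟨D, hD0, fun T hT U hU hU4 hUT s hs t hUt H hH v hv => ?_⟩
  rw [odW'_eq_odW w B T hU hU4 hs t]
  exact hD T hT U hU hU4 hUT s hs t hUt H hH v hv

/-- **(K2d for `W′`)** Joint continuity of `(t, t') ↦ 𝓜W′_{U,t}(it')`.
[cite: BondarenkoHeap2026, §6.2, TeX l.812] -/
theorem continuous_mellin_odW' (w : Bump) (B : ℕ) {T : ℝ} (hT : 1 ≤ T) {U : ℝ} (hU : 0 < U)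
    (hU4 : U ≤ 1 / 4) {s : ℤ} (hs : s = 1 ∨ s = -1) :
    Continuous fun p : ℝ × ℝ => mellin (odW' w B T U s p.1) (p.2 * I) := by
  have h : ∀ t, odW' w B T U s t = odW w B T U s t := fun t => odW'_eq_odW w B T hU hU4 hs t
  simp only [h]
  exact continuous_mellin_odW w B hT hU hU4 hs

end GuardedW

end Literature.NumberTheory.LFunctions.BondarenkoHeap2026
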